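import Mathlib
import HarnessLib
import Literature.MathematicalPhysics.QuantumFieldTheory.OSSectorContinuation
import Literature.MathematicalPhysics.QuantumFieldTheory.OSReconstructionNoE1Proofs
import Summits.QuantumFields.YangMills.Theorems.MirrorModularBoostsPlanarSpectralConeFrontEnd
import Literature.MathematicalPhysics.QuantumFieldTheory.OSHolomorphicVectors
import Summits.QuantumFields.YangMills.Theorems.MirrorModularBoostsPlanarSpectralConeOneGapSector
import Summits.QuantumFields.YangMills.Theorems.MirrorModularBoostsPlanarSpectralConeDiscSections
import Summits.QuantumFields.YangMills.Theorems.MirrorModularBoostsPlanarSpectralConeDensityOfParts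
import Summits.QuantumFields.YangMills.Theorems.MirrorModularBoostsPlanarSpectralConeWindowedDensity
import Summits.QuantumFields.YangMills.Theorems.MirrorModularBoostsPlanarSpectralConeTransfer
import Summits.QuantumFields.YangMills.Theorems.MirrorModularBoostsPlanarSpectralConeDelayedLever
import Summits.QuantumFields.YangMills.Theorems.MirrorModularBoostsPlanarSpectralConeSpanLinearity

/-!
# `TransparentRPWall.LabelledConeDiscSections` (stmt-QuantumFields-18618) — PROOF (candidate, strategist-written)

Piece 1 (FRONT END, labelled) of the crux-strategist split of `TransparentRPWall.LabelledPlanarSpectralCone`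
(stmt-QuantumFields-9910): for a labelled Schwinger family `S` over any label type `ι` on `ℝ⁴`, translation
invariant on `⁰𝒮` and reflection positive in pull-back form for the eight frames of the `(x₀,x₁)`-plane,
`h` its `e₀` OS reconstruction and `G` a strict cone chain with label string `k`, the diagonal matrix
element `b ↦ ⟪Ψ_G^k, e^{-tH} U(b e₁) Ψ_G^k⟫` has, for every `t > 0`, a holomorphic extension to the disc
of radius `t` bounded by ONE constant (delay `c = 0`).

This is the LABELLED PORT of the landed one-species front end `stub_discSections` of the proved sibling
`MirrorModularBoosts.PlanarSpectralCone` (stmt-QuantumFields-9664): `frames_labelled` (= `stub_coneChainFrames`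
with the pulled-back LABELLED reconstructions), `sectorData_labelled` (= `FrontEnd.coneSectorData` with label
strings; slots by the label-generic `stub_complexTimeSlot`), `thales_labelled`
(= `stub_discSections_of_sectorExtension` with the labelled read-back
`pairing_eq_inner_transfer_translate_labelled`), and the glue `labelledConeDiscSections_proof` (sector
engine `IsSectorData.exists_extension` + maximum principle `norm_extension_le` + Thales). Every label-free
lemma is the tree's, by name. The statement is INLINE (verbatim the body of the route decl
`Summit.QuantumFields.QCD.Theses.TransparentRPWall.LabelledConeDiscSections`), so the file imports no route
file and a prover can land it verbatim under `Summits/QuantumFields/QCD/Theorems/` (`--workitem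
stmt-QuantumFields-18618`); the gate's accept-time probe matches the decl by its definiens.
Written by planner-cstrat-stmt-QuantumFields-9910-r1-0 (lean check rc 0, 0 sorries). [folklore]
-/


noncomputable section

namespace Summit.QuantumFields.QCD.Theorems.LabelledConeDiscSectionsProof

open MeasureTheory Complex Set Filter
open scoped InnerProductSpace SchwartzMap ComplexConjugate
open Literature.MathematicalPhysics.QuantumLattice Literature.MathematicalPhysics.AQFT
  Literature.MathematicalPhysics.QuantumFieldTheory
open Summit.QuantumFields.YangMills.Cruxes.PlanarSpectralCone.TwoMirrorLightconeSlots
open Summit.QuantumFields.YangMills.Cruxes.PlanarSpectralCone.PositivityDiscToOperatorCone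

/-- Euclidean `ℝ⁴`, time = coordinate `0`, the boost plane = coordinates `0, 1`. -/
local notation "E4" => EuclideanSpace ℝ (Fin 4)

/-! ## The three steps (labelled ports) -/

/-- **Stub 1 — FRAMES (labelled `stub_coneChainFrames`).** For a labelled family `S` translation
invariant on `⁰𝒮` with the eight-frame pull-back RP and a cone chain `G`, the two `±45°` frames
`R₊, R₋` of the `(x₀,x₁)`-plane have pulled-back LABELLED families satisfying `OSReconstructionNoE1`,
and e₀-time-ordered `A±, B±` with `ΘG* ⊗ G_{a(u,u')} = linActMulti R₊ (ΘA₊* ⊗ (B₊)_{u e₀ − u' e₁})`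
`= linActMulti R₋ (ΘA₋* ⊗ (B₋)_{u' e₀ + u e₁})`. -/
theorem frames_labelled {ι : Type} (S : LabelledSchwingerFamily ι E4)
    (hT : ∀ (n : ℕ) (k : Fin n → ι) (a : E4) (F : SchwartzMap (Fin n → E4) ℂ), IsOffDiagonal F →
      S n k (translateMulti a F) = S n k F)
    (hRP : ∀ (R : E4 ≃ₗᵢ[ℝ] E4) (a b : ℝ), a ^ 2 + b ^ 2 = 1 → (a = 0 ∨ b = 0 ∨ a ^ 2 = b ^ 2) →
      R (EuclideanSpace.single 0 1) = a • EuclideanSpace.single 0 1 + b • EuclideanSpace.single 1 1 →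
      LabelledSchwingerFamily.IsReflectionPositive (fun n (k : Fin n → ι) => (S n k).comp (linActMulti R)))
    {m : ℕ} (G : SchwartzMap (Fin m → E4) ℂ)
    (hGcone : tsupport (G : (Fin m → E4) → ℂ) ⊆
      {x | (∀ i, |x i 1| < x i 0) ∧ ∀ i j, i < j → |x j 1 - x i 1| < x j 0 - x i 0}) :
    ∃ (Rp Rm : E4 ≃ₗᵢ[ℝ] E4) (Ap Bp Am Bm : SchwartzMap (Fin m → E4) ℂ),
      IsTimeOrdered Ap ∧ IsTimeOrdered Bp ∧ IsTimeOrdered Am ∧ IsTimeOrdered Bm ∧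
      OSReconstructionNoE1 (fun n (k : Fin n → ι) => (S n k).comp (linActMulti Rp)) ∧
      OSReconstructionNoE1 (fun n (k : Fin n → ι) => (S n k).comp (linActMulti Rm)) ∧
      (∀ u u' : ℝ, (osAdjoint G).appendTensor
          (translateMulti (((u + u') / Real.sqrt 2) • EuclideanSpace.single 0 1 +
            ((u - u') / Real.sqrt 2) • EuclideanSpace.single 1 1) G) =
        linActMulti Rp ((osAdjoint Ap).appendTensor
          (translateMulti (u • EuclideanSpace.single 0 1 + (-u') • EuclideanSpace.single 1 1) Bp))) ∧
      (∀ u u' : ℝ, (osAdjoint G).appendTensor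
          (translateMulti (((u + u') / Real.sqrt 2) • EuclideanSpace.single 0 1 +
            ((u - u') / Real.sqrt 2) • EuclideanSpace.single 1 1) G) =
        linActMulti Rm ((osAdjoint Am).appendTensor
          (translateMulti (u' • EuclideanSpace.single 0 1 + u • EuclideanSpace.single 1 1) Bm))) := by
  obtain ⟨Rp, hp0, hp1, hp0', -, hpi, hpθ, hpe⟩ := exists_diagFrame 1 (Or.inl rfl)
  obtain ⟨Rm, hm0, hm1, hm0', -, hmi, hmθ, hme⟩ := exists_diagFrame (-1) (Or.inr rfl)
  have hsq : Real.sqrt 2 ^ 2 = 2 := Real.sq_sqrt zero_le_two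
  have hle : ∀ r : ℝ, 1 * r ≤ |r| := fun r => by rw [one_mul]; exact le_abs_self r
  have hle' : ∀ r : ℝ, -1 * r ≤ |r| := fun r => by rw [neg_one_mul]; exact neg_le_abs r
  have hab : (1 / Real.sqrt 2) ^ 2 + (1 / Real.sqrt 2) ^ 2 = 1 := by
    rw [div_pow, one_pow, hsq]; norm_num
  have hab' : (1 / Real.sqrt 2) ^ 2 + (-1 / Real.sqrt 2) ^ 2 = 1 := by
    rw [div_pow, div_pow, one_pow, hsq]; norm_num
  have h8' : (1 / Real.sqrt 2) ^ 2 = (-1 / Real.sqrt 2) ^ 2 := by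
    rw [div_pow, div_pow]; norm_num
  -- `OSReconstructionNoE1` of a pulled-back LABELLED family
  have pull : ∀ (R : E4 ≃ₗᵢ[ℝ] E4) (a b : ℝ), a ^ 2 + b ^ 2 = 1 → (a = 0 ∨ b = 0 ∨ a ^ 2 = b ^ 2) →
      R (EuclideanSpace.single 0 1) = a • EuclideanSpace.single 0 1 + b • EuclideanSpace.single 1 1 →
      OSReconstructionNoE1 (fun n (k : Fin n → ι) => (S n k).comp (linActMulti R)) := by
    intro R a b hab₀ h8 hR
    refine ⟨hRP R a b hab₀ h8 hR, fun n k c F hF => ?_⟩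
    show S n k (linActMulti R (translateMulti c F)) = S n k (linActMulti R F)
    rw [linActMulti_translateMulti]
    exact hT n k (R c) _ (isOffDiagonal_linActMulti_four hF R)
  refine ⟨Rp, Rm, linActMulti Rp G, linActMulti Rp.symm G, linActMulti Rm G, linActMulti Rm.symm G,
    ?_, ?_, ?_, ?_, ?_, ?_, fun u u' => ?_, fun u u' => ?_⟩
  · exact isTimeOrdered_linActMulti_of_cone Rp (-1) hle' (fun x => by rw [hp0]; ring) G hGcone
  · exact isTimeOrdered_linActMulti_of_cone Rp.symm 1 hle hp0' G hGcone
  · exact isTimeOrdered_linActMulti_of_cone Rm 1 hle (fun x => by rw [hm0]; ring) G hGcone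
  · exact isTimeOrdered_linActMulti_of_cone Rm.symm (-1) hle' hm0' G hGcone
  · exact pull Rp _ _ hab (Or.inr (Or.inr rfl)) hpe
  · exact pull Rm _ _ hab' (Or.inr (Or.inr h8')) hme
  · have hv : Rp (u • EuclideanSpace.single 0 1 + (-u') • EuclideanSpace.single 1 1) =
        ((u + u') / Real.sqrt 2) • EuclideanSpace.single 0 1 +
          ((u - u') / Real.sqrt 2) • EuclideanSpace.single 1 1 := by
      ext i
      fin_cases i
      · simp [hp0]; ring
      · simp [hp1]; ring
      · simp [(hpi _ 2 (by decide) (by decide)).1]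
      · simp [(hpi _ 3 (by decide) (by decide)).1]
    rw [← hv]
    exact pairing_pullback Rp hpθ G _
  · have hv : Rm (u' • EuclideanSpace.single 0 1 + u • EuclideanSpace.single 1 1) =
        ((u + u') / Real.sqrt 2) • EuclideanSpace.single 0 1 +
          ((u - u') / Real.sqrt 2) • EuclideanSpace.single 1 1 := by
      ext i
      fin_cases i
      · simp [hm0]; ring
      · simp [hm1]; ring
      · simp [(hmi _ 2 (by decide) (by decide)).1]
      · simp [(hmi _ 3 (by decide) (by decide)).1]
    rw [← hv]
    exact pairing_pullback Rm hmθ G _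

/-- **Read-back of a translated LABELLED pairing**: for time-ordered `A` (labels `k`), `B` (labels
`k'`) in the OS space of a labelled family `S'`,
`𝔖'_{n+m}^{rev k ++ k'}(ΘA* ⊗ B_{t e₀ + b e₁}) = ⟪Ψ_A^k, e^{-tH} U(b e₁) Ψ_B^{k'}⟫` (`t ≥ 0`). -/
theorem pairing_eq_inner_transfer_translate_labelled {ι : Type} (S' : LabelledSchwingerFamily ι E4)
    (h' : OSReconstructionNoE1 S')
    {n m : ℕ} (k : Fin n → ι) (k' : Fin m → ι) (A : SchwartzMap (Fin n → E4) ℂ) (B : SchwartzMap (Fin m → E4) ℂ)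
    (hA : IsTimeOrdered A) (hB : IsTimeOrdered B) {t : ℝ} (ht : 0 ≤ t) (b : ℝ) :
    S' (n + m) (Fin.append (k ∘ Fin.rev) k') ((osAdjoint A).appendTensor
        (translateMulti (t • EuclideanSpace.single 0 1 + b • EuclideanSpace.single 1 1) B)) =
      ⟪h'.fieldVec n k A hA,
        h'.transfer t (h'.translate (b • EuclideanSpace.single 1 1) (h'.fieldVec m k' B hB))⟫_ℂ := by
  rw [OSReconstructionNoE1.translate_fieldVec, OSReconstructionNoE1.transfer_fieldVec _ ht]
  have hH : IsAppendTensorOf ((osAdjoint A).appendTensor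
      (translateMulti (t • EuclideanSpace.single 0 1 + b • EuclideanSpace.single 1 1) B)) (osAdjoint A)
      (translateMulti (SchwingerFamily.timeVec t)
        (translateMulti (spatialPart 0 (b • (EuclideanSpace.single 1 1 : E4))) B)) := by
    rw [DiscSections.translateMulti_time_space]; exact isAppendTensorOf_appendTensor _ _
  rw [h'.inner_fieldVec_fieldVec k k' hA _ hH]

/-- **Stub 2 — SECTOR DATA (labelled `FrontEnd.coneSectorData`).** From the frame data of stub 1,
the function `φ_G^k(u,u') = 𝔖_{2m}^{rev k ++ k}(ΘG* ⊗ G_{a(u,u')})` with its two diagonal-semigroup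
slots is `LogSlot.IsSectorData (π/2) φ_G^k E M 0 (fun _ => M)`; the base bound `‖Ψ_G^k‖²` is read in
the `e₀` frame. -/
theorem sectorData_labelled {ι : Type} (S : LabelledSchwingerFamily ι E4) (h : OSReconstructionNoE1 S)
    {m : ℕ} (k : Fin m → ι) (G : SchwartzMap (Fin m → E4) ℂ) (hG : IsTimeOrdered G)
    (Rp Rm : E4 ≃ₗᵢ[ℝ] E4) (Ap Bp Am Bm : SchwartzMap (Fin m → E4) ℂ)
    (hAp : IsTimeOrdered Ap) (hBp : IsTimeOrdered Bp) (hAm : IsTimeOrdered Am) (hBm : IsTimeOrdered Bm)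
    (hp : OSReconstructionNoE1 (fun n (k : Fin n → ι) => (S n k).comp (linActMulti Rp)))
    (hm : OSReconstructionNoE1 (fun n (k : Fin n → ι) => (S n k).comp (linActMulti Rm)))
    (hidp : ∀ u u' : ℝ, (osAdjoint G).appendTensor
        (translateMulti (((u + u') / Real.sqrt 2) • EuclideanSpace.single 0 1 +
          ((u - u') / Real.sqrt 2) • EuclideanSpace.single 1 1) G) =
      linActMulti Rp ((osAdjoint Ap).appendTensor
        (translateMulti (u • EuclideanSpace.single 0 1 + (-u') • EuclideanSpace.single 1 1) Bp)))
    (hidm : ∀ u u' : ℝ, (osAdjoint G).appendTensor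
        (translateMulti (((u + u') / Real.sqrt 2) • EuclideanSpace.single 0 1 +
          ((u - u') / Real.sqrt 2) • EuclideanSpace.single 1 1) G) =
      linActMulti Rm ((osAdjoint Am).appendTensor
        (translateMulti (u' • EuclideanSpace.single 0 1 + u • EuclideanSpace.single 1 1) Bm))) :
    ∃ (M : ℝ) (E : Fin 2 → (Fin 1 → ℝ) → ℂ → ℂ),
      LogSlot.IsSectorData (Real.pi / 2)
        (fun u : Fin 2 → ℝ => S (m + m) (Fin.append (k ∘ Fin.rev) k) ((osAdjoint G).appendTensor
          (translateMulti (((u 0 + u 1) / Real.sqrt 2) • EuclideanSpace.single 0 1 +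
            ((u 0 - u 1) / Real.sqrt 2) • EuclideanSpace.single 1 1) G)))
        E M 0 (fun _ => M) := by
  -- the two complex-time slots in the pulled-back reconstructions
  obtain ⟨Cp, Ep, hEpd, hEpc, hEpb, hEpr⟩ :=
    stub_complexTimeSlot hp (hp.fieldVec m k Ap hAp) (hp.fieldVec m k Bp hBp)
  obtain ⟨Cm, Em, hEmd, hEmc, hEmb, hEmr⟩ :=
    stub_complexTimeSlot hm (hm.fieldVec m k Am hAm) (hm.fieldVec m k Bm hBm)
  set ψG := h.fieldVec m k G hG with hψG
  set M : ℝ := max (‖ψG‖ ^ 2) (max Cp Cm) with hM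
  set Sfun : (Fin 2 → ℝ) → ℂ := fun u => S (m + m) (Fin.append (k ∘ Fin.rev) k) ((osAdjoint G).appendTensor
    (translateMulti (((u 0 + u 1) / Real.sqrt 2) • EuclideanSpace.single 0 1 +
      ((u 0 - u 1) / Real.sqrt 2) • EuclideanSpace.single 1 1) G)) with hSfun
  set E : Fin 2 → (Fin 1 → ℝ) → ℂ → ℂ :=
    ![fun u' τ => Ep ((-(u' 0)) • EuclideanSpace.single 1 1) τ,
      fun u' τ => Em ((u' 0) • EuclideanSpace.single 1 1) τ] with hE
  have hM0 : 0 ≤ M := le_trans (by positivity) (le_max_left _ _)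
  -- base values in the e₀ frame
  have hbase : ∀ u : Fin 2 → ℝ, (∀ j, 0 < u j) → ‖Sfun u‖ ≤ ‖ψG‖ ^ 2 := by
    intro u hu
    have ht : 0 ≤ (u 0 + u 1) / Real.sqrt 2 := by
      have := hu 0; have := hu 1; positivity
    have e := pairing_eq_inner_transfer_translate_labelled S h k k G G hG hG ht
      ((u 0 - u 1) / Real.sqrt 2)
    simp only [hSfun]
    rw [e]
    calc ‖⟪ψG, h.transfer ((u 0 + u 1) / Real.sqrt 2)
            (h.translate (((u 0 - u 1) / Real.sqrt 2) • EuclideanSpace.single 1 1) ψG)⟫_ℂ‖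
        ≤ ‖ψG‖ * ‖h.transfer ((u 0 + u 1) / Real.sqrt 2)
            (h.translate (((u 0 - u 1) / Real.sqrt 2) • EuclideanSpace.single 1 1) ψG)‖ :=
          norm_inner_le_norm _ _
      _ ≤ ‖ψG‖ * ‖ψG‖ := by
          gcongr
          refine (h.norm_transfer_le _ _).trans ?_
          rw [LinearIsometryEquiv.norm_map]
      _ = ‖ψG‖ ^ 2 := by ring
  -- real values of the two slots
  have hreal_p : ∀ (x y : ℝ), 0 < x →
      Ep ((-y) • EuclideanSpace.single 1 1) (x : ℂ) = Sfun ![x, y] := by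
    intro x y hx
    rw [hEpr _ (by simp) x hx]
    simp only [hSfun, Matrix.cons_val_zero, Matrix.cons_val_one]
    rw [hidp x y]
    exact (pairing_eq_inner_transfer_translate_labelled (fun n κ => (S n κ).comp (linActMulti Rp)) hp
      k k Ap Bp hAp hBp hx.le (-y)).symm
  have hreal_m : ∀ (x y : ℝ), 0 < x →
      Em (y • EuclideanSpace.single 1 1) (x : ℂ) = Sfun ![y, x] := by
    intro x y hx
    rw [hEmr _ (by simp) x hx]
    simp only [hSfun, Matrix.cons_val_zero, Matrix.cons_val_one]
    rw [hidm y x]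
    exact (pairing_eq_inner_transfer_translate_labelled (fun n κ => (S n κ).comp (linActMulti Rm)) hm
      k k Am Bm hAm hBm hx.le y).symm
  refine ⟨M, E, ?_, hM0, ?_, ?_, ?_, fun _ => hM0, ?_, ?_⟩
  · -- continuity of φ_G^k on the open quadrant (translations are continuous on 𝒮)
    have hc := OSReconstructionNoE1.continuous_apply_appendTensor_translateMulti S
      ⟨m, k, G, hG⟩ ⟨m, k, G, hG⟩
    have hv : Continuous fun u : Fin 2 → ℝ =>
        (((u 0 + u 1) / Real.sqrt 2) • EuclideanSpace.single 0 1 +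
          ((u 0 - u 1) / Real.sqrt 2) • EuclideanSpace.single 1 1 : EuclideanSpace ℝ (Fin 4)) := by
      fun_prop
    exact (hc.comp hv).continuousOn
  · intro u hu
    rw [pow_zero, mul_one]
    exact (hbase u hu).trans (le_max_left _ _)
  · intro i τ hτ
    fin_cases i
    · simp only [hE, Fin.zero_eta, Fin.isValue, Matrix.cons_val_zero]
      exact ((hEpc τ hτ.1).comp (by fun_prop)).continuousOn
    · simp only [hE, Fin.mk_one, Fin.isValue, Matrix.cons_val_one, Matrix.cons_val_fin_one]
      exact ((hEmc τ hτ.1).comp (by fun_prop)).continuousOn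
  · intro i u' hu'
    fin_cases i
    · simpa [hE] using (hEpd _).mono fun τ hτ => hτ.1
    · simpa [hE] using (hEmd _).mono fun τ hτ => hτ.1
  · intro i c _ u' τ _ hτ _
    rw [pow_zero, pow_zero, mul_one, mul_one]
    fin_cases i
    · have := hEpb ((-(u' 0)) • EuclideanSpace.single 1 1) τ hτ
      simp only [hE, Fin.zero_eta, Fin.isValue, Matrix.cons_val_zero]
      exact this.trans ((le_max_left _ _).trans (le_max_right _ _))
    · have := hEmb ((u' 0) • EuclideanSpace.single 1 1) τ hτ
      simp only [hE, Fin.mk_one, Fin.isValue, Matrix.cons_val_one, Matrix.cons_val_fin_one]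
      exact this.trans ((le_max_right _ _).trans (le_max_right _ _))
  · intro i u' _ x hx
    fin_cases i
    · simp only [hE, Fin.zero_eta, Fin.isValue, Matrix.cons_val_zero]
      rw [hreal_p x (u' 0) hx]
      congr 1
      funext j
      fin_cases j
      · simp
      · simp
    · simp only [hE, Fin.mk_one, Fin.isValue, Matrix.cons_val_one, Matrix.cons_val_fin_one]
      rw [hreal_m x (u' 0) hx]
      have h0 : (1 : Fin 2).succAbove (0 : Fin 1) = 0 := by decide
      have h0' : Fin.insertNth (α := fun _ : Fin 2 => ℝ) (1 : Fin 2) x u' 0 = u' 0 := by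
        conv_lhs => rw [← h0]
        rw [Fin.insertNth_apply_succAbove]
      congr 1
      funext j
      fin_cases j
      · simp [h0']
      · simp

/-- **Stub 3 — THALES, labelled read-back (labelled `stub_discSections_of_sectorExtension`).** A
bounded holomorphic extension `Φ` of `φ_G^k` to the two-slot sector region gives, on every slice
`u + u' = √2 t`, a function holomorphic on the disc `|β| < t`, bounded by `M`, equal at real `b` to
`⟪Ψ_G^k, e^{-tH} U(b e₁) Ψ_G^k⟫`. -/
theorem thales_labelled {ι : Type} (S : LabelledSchwingerFamily ι E4) (h : OSReconstructionNoE1 S)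
    {m : ℕ} (k : Fin m → ι) (G : SchwartzMap (Fin m → E4) ℂ) (hG : IsTimeOrdered G)
    (M : ℝ) (Φ : (Fin 2 → ℂ) → ℂ)
    (hΦd : DifferentiableOn ℂ Φ (Literature.Analysis.Complex.sectorRegion 1 (Real.pi / 2)))
    (hΦb : ∀ w ∈ Literature.Analysis.Complex.sectorRegion 1 (Real.pi / 2), ‖Φ w‖ ≤ M)
    (hΦr : ∀ u : Fin 2 → ℝ, (∀ j, 0 < u j) →
      Φ (fun j => (u j : ℂ)) = S (m + m) (Fin.append (k ∘ Fin.rev) k) ((osAdjoint G).appendTensor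
        (translateMulti (((u 0 + u 1) / Real.sqrt 2) • EuclideanSpace.single 0 1 +
          ((u 0 - u 1) / Real.sqrt 2) • EuclideanSpace.single 1 1) G))) :
    ∀ t : ℝ, 0 < t → ∃ f : ℂ → ℂ, DifferentiableOn ℂ f (Metric.ball 0 t) ∧
      (∀ z ∈ Metric.ball (0 : ℂ) t, ‖f z‖ ≤ M) ∧
      ∀ b : ℝ, |b| < t → f b = ⟪h.fieldVec m k G hG,
        h.transfer t (h.translate (b • EuclideanSpace.single 1 1) (h.fieldVec m k G hG))⟫_ℂ := by
  intro t ht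
  -- the light-cone coordinate map of the slice `ζ = t`
  set g : ℂ → (Fin 2 → ℂ) := fun β =>
    (![((t : ℂ) + β) / (Real.sqrt 2 : ℂ), ((t : ℂ) - β) / (Real.sqrt 2 : ℂ)] : Fin 2 → ℂ) with hg
  have hmaps : MapsTo g (Metric.ball (0 : ℂ) t)
      (Literature.Analysis.Complex.sectorRegion 1 (Real.pi / 2)) := by
    intro β hβ
    rw [Metric.mem_ball, dist_zero_right] at hβ
    exact DiscSections.lightCone_mem_sectorRegion hβ
  have hgd : Differentiable ℂ g := DiscSections.differentiable_lightCone t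
  refine ⟨Φ ∘ g, hΦd.comp hgd.differentiableOn hmaps, fun z hz => hΦb _ (hmaps hz), ?_⟩
  intro b hb
  have hgb : g b = fun j =>
      (((![(t + b) / Real.sqrt 2, (t - b) / Real.sqrt 2] : Fin 2 → ℝ) j : ℝ) : ℂ) :=
    DiscSections.lightCone_ofReal t b
  show Φ (g b) = _
  rw [hgb, hΦr _ (DiscSections.lightCone_real_pos hb)]
  simp only [Matrix.cons_val_zero, Matrix.cons_val_one, Matrix.cons_val_fin_one]
  rw [DiscSections.lightCone_real_sum, DiscSections.lightCone_real_sub]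
  exact pairing_eq_inner_transfer_translate_labelled S h k k G G hG hG ht.le b

/-! ## The piece -/

/-- **THE PIECE FROM THE STUBS, BY NAME**: frames → sector data → the tree's sector engine and
maximum principle (`IsSectorData.exists_extension`, `norm_extension_le`) → Thales; delay `c = 0`. -/
theorem labelledConeDiscSections_proof :
    (open Literature.MathematicalPhysics.QuantumLattice Literature.MathematicalPhysics.AQFT Literature.MathematicalPhysics.QuantumFieldTheory in let E := EuclideanSpace ℝ (Fin 4); ∀ (ι : Type) (S : LabelledSchwingerFamily ι E), (∀ (n : ℕ) (k : Fin n → ι) (a : E) (F : SchwartzMap (Fin n → E) ℂ), IsOffDiagonal F → S n k (translateMulti a F) = S n k F) → (∀ (R : E ≃ₗᵢ[ℝ] E) (a b : ℝ), a ^ 2 + b ^ 2 = 1 → (a = 0 ∨ b = 0 ∨ a ^ 2 = b ^ 2) → R (EuclideanSpace.single 0 1) = a • EuclideanSpace.single 0 1 + b • EuclideanSpace.single 1 1 → LabelledSchwingerFamily.IsReflectionPositive (fun n (k : Fin n → ι) => (S n k).comp (linActMulti R))) → ∀ (h : OSReconstructionNoE1 S) (m : ℕ) (k : Fin m → ι)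 (G : SchwartzMap (Fin m → E) ℂ) (hG : IsTimeOrdered G), tsupport (G : (Fin m → E) → ℂ) ⊆ {x | (∀ i, |x i 1| < x i 0) ∧ ∀ i j, i < j → |x j 1 - x i 1| < x j 0 - x i 0} → ∃ c M : ℝ, 0 ≤ c ∧ ∀ t : ℝ, c < t → ∃ f : ℂ → ℂ, DifferentiableOn ℂ f (Metric.ball 0 (t - c)) ∧ (∀ z ∈ Metric.ball (0 : ℂ) (t - c), ‖f z‖ ≤ M) ∧ ∀ b : ℝ, |b| < t - c → f b = inner ℂ (h.fieldVec m k G hG) (h.transfer t (h.translate (EuclideanSpace.single 1 b) (h.fieldVec m k G hG)))) := by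
  intro E ι S htr hRP h m k G hG hC
  obtain ⟨Rp, Rm, Ap, Bp, Am, Bm, hAp, hBp, hAm, hBm, hp, hm, hidp, hidm⟩ := frames_labelled S htr hRP G hC
  obtain ⟨M, Esl, hdata⟩ := sectorData_labelled S h k G hG Rp Rm Ap Bp Am Bm hAp hBp hAm hBm hp hm hidp hidm
  -- the sector engine and the maximum principle on the flat tubes (through every opening `c < π/2`)
  obtain ⟨Φ, hΦd, hΦr⟩ := hdata.exists_extension (by positivity) le_rfl
  have hΦb : ∀ w ∈ Literature.Analysis.Complex.sectorRegion 1 (Real.pi / 2), ‖Φ w‖ ≤ M := by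
    intro w hw
    obtain ⟨c, hc1, hc2⟩ := exists_between hw.2
    have hc0 : 0 < c := lt_of_le_of_lt (Finset.sum_nonneg fun j _ => abs_nonneg _) hc1
    exact hdata.norm_extension_le le_rfl hΦd hΦr hc0 hc2
      (fun u hu => by simpa using hdata.bound u hu)
      (fun i u' τ hu' hτ hτc => by simpa using hdata.slot_bound i c hc2 u' τ hu' hτ hτc)
      ⟨hw.1, hc1⟩
  -- Thales on every slice, delay `c = 0`
  have hdisc := thales_labelled S h k G hG M Φ hΦd hΦb hΦr
  refine ⟨0, M, le_rfl, fun t ht => ?_⟩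
  obtain ⟨f, hf, hfM, hfb⟩ := hdisc t ht
  rw [sub_zero]
  refine ⟨f, hf, hfM, fun b hb => ?_⟩
  rw [hfb b hb, FrontEnd.single_one_eq_smul b]

end Summit.QuantumFields.QCD.Theorems.LabelledConeDiscSectionsProof

end


/-! # X2 port — Parts A (labelled kinematics) and B (labelled temperedness bounds) -/

noncomputable section

namespace Summit.QuantumFields.QCD.Theorems.LabelledConeChainDensityProof

open MeasureTheory Complex Set Filter
open scoped InnerProductSpace SchwartzMap ComplexConjugate Topology
open Literature.MathematicalPhysics.QuantumLattice Literature.MathematicalPhysics.AQFT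
  Literature.MathematicalPhysics.QuantumFieldTheory
open Summit.QuantumFields.YangMills.Cruxes.PlanarSpectralCone.PositivityDiscToOperatorCone
open Summit.QuantumFields.YangMills.Cruxes.PlanarSpectralCone.PositivityDiscToOperatorCone.OneGap
open Literature.Analysis.Complex

/-- Euclidean `ℝ⁴`. -/
local notation "E4" => EuclideanSpace ℝ (Fin 4)

namespace OneGapL

/-! ### A. Labelled kinematics: arity casts with label strings, the re-centred pairing identity -/

/-- A labelled family does not see an arity cast `Fin N = Fin N'` once the label string is transported. -/
theorem apply_cast_arity_labelled {ι : Type} (S : LabelledSchwingerFamily ι E4) {N N' : ℕ} (hN : N = N')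
    (κ : Fin N' → ι) (G : 𝓢((Fin N → E4), ℂ)) :
    S N' κ (cast (congrArg (fun M => 𝓢((Fin M → E4), ℂ)) hN) G) = S N (κ ∘ Fin.cast hN) G := by
  subst hN; rfl

/-- **Label bookkeeping for the re-centring.** Reading the label string `rev κ ++ κ` of
`Θ(P ⊗ Q_s)* ⊗ (P ⊗ Q_{s'})` through the arity cast `(k+l)+(k+l) = l+(k+(k+l))` gives the label string
`rev κ_Q ++ (rev κ_P ++ κ)` of `ΘQ'* ⊗ R(s')`, where `κ_P = κ ∘ castAdd l`, `κ_Q = κ ∘ natAdd k`. -/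
theorem labels_recentre {ι : Type} {k l : ℕ} (κ : Fin (k + l) → ι)
    (hN : (k + l) + (k + l) = l + (k + (k + l))) :
    (Fin.append ((fun j : Fin l => κ (Fin.natAdd k j)) ∘ Fin.rev)
        (Fin.append ((fun i : Fin k => κ (Fin.castAdd l i)) ∘ Fin.rev) κ)) ∘ Fin.cast hN =
      Fin.append (κ ∘ Fin.rev) κ := by
  -- the four index identities (values in `Fin (l + (k + (k + l)))`)
  have I1 : ∀ i : Fin k, Fin.cast hN (Fin.castAdd (k + l) (Fin.castAdd l i).rev) =
      Fin.natAdd l (Fin.castAdd (k + l) i.rev) := fun i => by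
    apply Fin.ext; simp only [Fin.val_cast, Fin.val_castAdd, Fin.val_rev, Fin.val_natAdd]; omega
  have I2 : ∀ i : Fin l, Fin.cast hN (Fin.castAdd (k + l) (Fin.natAdd k i).rev) =
      Fin.castAdd (k + (k + l)) i.rev := fun i => by
    apply Fin.ext; simp only [Fin.val_cast, Fin.val_castAdd, Fin.val_rev, Fin.val_natAdd]; omega
  have I3 : ∀ i : Fin k, Fin.cast hN (Fin.natAdd (k + l) (Fin.castAdd l i)) =
      Fin.natAdd l (Fin.natAdd k (Fin.castAdd l i)) := fun i => by
    apply Fin.ext; simp only [Fin.val_cast, Fin.val_castAdd, Fin.val_natAdd]; omega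
  have I4 : ∀ i : Fin l, Fin.cast hN (Fin.natAdd (k + l) (Fin.natAdd k i)) =
      Fin.natAdd l (Fin.natAdd k (Fin.natAdd k i)) := fun i => by
    apply Fin.ext; simp only [Fin.val_cast, Fin.val_natAdd]; omega
  funext x
  simp only [Function.comp_apply]
  induction x using Fin.addCases with
  | left i =>
    -- `x = castAdd (k+l) i`; write `i = j.rev` and split `j`
    obtain ⟨j, rfl⟩ : ∃ j : Fin (k + l), i = j.rev := ⟨i.rev, (Fin.rev_rev i).symm⟩
    rw [Fin.append_left, Function.comp_apply, Fin.rev_rev]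
    induction j using Fin.addCases with
    | left a => rw [I1, Fin.append_right, Fin.append_left, Function.comp_apply, Fin.rev_rev]
    | right b => rw [I2, Fin.append_left, Function.comp_apply, Fin.rev_rev]
  | right i =>
    rw [Fin.append_right]
    induction i using Fin.addCases with
    | left a => rw [I3, Fin.append_right, Fin.append_right]
    | right b => rw [I4, Fin.append_right, Fin.append_right]

/-- **The re-centred pairing identity, LABELLED.** For `s ≥ 0` and a label string `κ` on the `k + l`
points of `P ⊗ Q`,
`⟪Ψ^κ_{P⊗Q_{se₀}}, Ψ^κ_{P⊗Q_{s'e₀}}⟫ = ⟪Ψ^{κ_Q}_{Q_{−Te₀}}, e^{-sH} Ψ^{rev κ_P ++ κ}_{R(s')}⟫`,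
`R(s') = (ΘP* ⊗ (P ⊗ Q_{s'e₀}))_{+Te₀}` (translation invariance on `⁰𝒮` by `(T+s)e₀`, arity cast with
`labels_recentre`). -/
theorem inner_stretch_eq_labelled {ι : Type} (S : LabelledSchwingerFamily ι E4)
    (h : OSReconstructionNoE1 S) {k l : ℕ} (κ : Fin (k + l) → ι)
    (P : 𝓢((Fin k → E4), ℂ)) (Q : 𝓢((Fin l → E4), ℂ))
    (T : ℝ) {s s' : ℝ} (hs : 0 ≤ s)
    (h1 : IsTimeOrdered (P.appendTensor (translateMulti (SchwingerFamily.timeVec s) Q)))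
    (h2 : IsTimeOrdered (P.appendTensor (translateMulti (SchwingerFamily.timeVec s') Q)))
    (h3 : IsTimeOrdered (translateMulti (SchwingerFamily.timeVec (-T)) Q))
    (h4 : IsTimeOrdered (translateMulti (SchwingerFamily.timeVec T)
      ((osAdjoint P).appendTensor (P.appendTensor (translateMulti (SchwingerFamily.timeVec s') Q))))) :
    ⟪h.fieldVec (k + l) κ (P.appendTensor (translateMulti (SchwingerFamily.timeVec s) Q)) h1,
      h.fieldVec (k + l) κ (P.appendTensor (translateMulti (SchwingerFamily.timeVec s') Q)) h2⟫_ℂ =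
    ⟪h.fieldVec l (fun j : Fin l => κ (Fin.natAdd k j)) (translateMulti (SchwingerFamily.timeVec (-T)) Q) h3,
      h.transfer s (h.fieldVec (k + (k + l))
        (Fin.append ((fun i : Fin k => κ (Fin.castAdd l i)) ∘ Fin.rev) κ)
        (translateMulti (SchwingerFamily.timeVec T)
          ((osAdjoint P).appendTensor (P.appendTensor (translateMulti (SchwingerFamily.timeVec s') Q)))) h4)⟫_ℂ := by
  have hN : (k + l) + (k + l) = l + (k + (k + l)) := by ring
  rw [h.inner_fieldVec_fieldVec _ _ _ _ (isAppendTensorOf_appendTensor _ _),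
    OSReconstructionNoE1.transfer_fieldVec _ hs,
    h.inner_fieldVec_fieldVec _ _ _ _ (isAppendTensorOf_recentre P Q T s s' hN),
    apply_cast_arity_labelled S hN, labels_recentre κ hN]
  exact (h.translationInvariant ((k + l) + (k + l)) _ (SchwingerFamily.timeVec (T + s)) _
    (OSReconstructionNoE1.isOffDiagonal_appendTensor_osAdjoint h1 h2)).symm

/-! ### B. Labelled temperedness bounds (any single functional `L = 𝔖_N^{lab}`) -/

/-- **The pairing is tempered** for any continuous functional `L` with E0 bound `(M, C₀)`. -/
theorem norm_apply_osAdjoint_appendTensor_le' {a b : ℕ} (L : 𝓢((Fin (a + b) → E4), ℂ) →L[ℂ] ℂ)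
    {M : ℕ} {C₀ : ℝ}
    (hS : ∀ F : 𝓢((Fin (a + b) → E4), ℂ), ‖L F‖ ≤ C₀ * schwartzNorm M F)
    (A : 𝓢((Fin a → E4), ℂ)) (B : 𝓢((Fin b → E4), ℂ)) :
    ‖L ((osAdjoint A).appendTensor B)‖ ≤
      |C₀| * (2 ^ (M + 1) * schwartzNorm M A * schwartzNorm M B) := by
  have hA := schwartzNorm_nonneg M A
  have hB := schwartzNorm_nonneg M B
  calc ‖L ((osAdjoint A).appendTensor B)‖
      ≤ C₀ * schwartzNorm M ((osAdjoint A).appendTensor B) := hS _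
    _ ≤ |C₀| * schwartzNorm M ((osAdjoint A).appendTensor B) :=
        mul_le_mul_of_nonneg_right (le_abs_self _) (schwartzNorm_nonneg _ _)
    _ ≤ |C₀| * (2 ^ (M + 1) * schwartzNorm M (osAdjoint A) * schwartzNorm M B) :=
        mul_le_mul_of_nonneg_left (schwartzNorm_appendTensor_le _ _ _) (abs_nonneg _)
    _ ≤ |C₀| * (2 ^ (M + 1) * schwartzNorm M A * schwartzNorm M B) := by
        gcongr
        exact schwartzNorm_osAdjoint_le A M

/-- An E0 bound for a single continuous functional on `𝓢((ℝ⁴)^N)` (temperedness is automatic). -/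
theorem exists_bound' {N : ℕ} (L : 𝓢((Fin N → E4), ℂ) →L[ℂ] ℂ) :
    ∃ (M : ℕ) (C₀ : ℝ), ∀ F : 𝓢((Fin N → E4), ℂ), ‖L F‖ ≤ C₀ * schwartzNorm M F := by
  classical
  obtain ⟨M, C₀, hS⟩ := SchwingerFamily.exists_bound_holds (Function.update (0 : SchwingerFamily E4) N L) N
  simp only [Function.update_self] at hS
  exact ⟨M, C₀, hS⟩

/-- **The Gram kernel of the stretched pair is polynomially bounded** (any functional `L` at arity
`(k+l)+(k+l)`): `|L(Θ(P⊗Q_{se₀})* ⊗ (P⊗Q_{s'e₀}))| ≤ C ((1+|s|)(1+|s'|))^p`. -/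
theorem exists_norm_kernel_le' {k l : ℕ} (L : 𝓢((Fin ((k + l) + (k + l)) → E4), ℂ) →L[ℂ] ℂ)
    (P : 𝓢((Fin k → E4), ℂ)) (Q : 𝓢((Fin l → E4), ℂ)) :
    ∃ (C : ℝ) (p : ℕ), 0 ≤ C ∧ ∀ s s' : ℝ,
      ‖L ((osAdjoint (P.appendTensor (translateMulti (SchwingerFamily.timeVec s) Q))).appendTensor
        (P.appendTensor (translateMulti (SchwingerFamily.timeVec s') Q)))‖ ≤
        C * ((1 + |s|) * (1 + |s'|)) ^ p := by
  obtain ⟨M, C₀, hS⟩ := exists_bound' L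
  set A : ℝ := 2 ^ (M + 1) * schwartzNorm M P * (2 ^ M * (2 * schwartzNorm M Q)) with hA
  have hA0 : 0 ≤ A := by have := schwartzNorm_nonneg M P; have := schwartzNorm_nonneg M Q; positivity
  refine ⟨|C₀| * (2 ^ (M + 1) * A * A), M, by positivity, fun s s' => ?_⟩
  refine (norm_apply_osAdjoint_appendTensor_le' L hS _ _).trans ?_
  have h1 := schwartzNorm_stretch_le M P Q s
  have h2 := schwartzNorm_stretch_le M P Q s'
  have hs : (0 : ℝ) ≤ (1 + |s|) ^ M := by positivity
  have hs' : (0 : ℝ) ≤ (1 + |s'|) ^ M := by positivity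
  have h12 : schwartzNorm M (P.appendTensor (translateMulti (SchwingerFamily.timeVec s) Q)) *
      schwartzNorm M (P.appendTensor (translateMulti (SchwingerFamily.timeVec s') Q)) ≤
      (A * (1 + |s|) ^ M) * (A * (1 + |s'|) ^ M) :=
    mul_le_mul h1 h2 (schwartzNorm_nonneg _ _) (by positivity)
  calc |C₀| * (2 ^ (M + 1) * schwartzNorm M (P.appendTensor (translateMulti (SchwingerFamily.timeVec s) Q)) *
        schwartzNorm M (P.appendTensor (translateMulti (SchwingerFamily.timeVec s') Q)))
      ≤ |C₀| * (2 ^ (M + 1) * ((A * (1 + |s|) ^ M) * (A * (1 + |s'|) ^ M))) := by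
        rw [mul_assoc (2 ^ (M + 1) : ℝ)]
        exact mul_le_mul_of_nonneg_left (mul_le_mul_of_nonneg_left h12 (by positivity)) (abs_nonneg _)
    _ = |C₀| * (2 ^ (M + 1) * A * A) * ((1 + |s|) * (1 + |s'|)) ^ M := by rw [mul_pow]; ring

/-- **The re-centred block is polynomially bounded in norm squared** (any functional `L` at arity
`(k+(k+l))+(k+(k+l))`): `|L(ΘR(σ)* ⊗ R(σ))| ≤ C (1+|σ|)^p`. -/
theorem exists_norm_recentre_sq_le' {k l : ℕ}
    (L : 𝓢((Fin ((k + (k + l)) + (k + (k + l))) → E4), ℂ) →L[ℂ] ℂ)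
    (P : 𝓢((Fin k → E4), ℂ)) (Q : 𝓢((Fin l → E4), ℂ)) (T : ℝ) :
    ∃ (C : ℝ) (p : ℕ), 0 ≤ C ∧ ∀ σ : ℝ,
      ‖L ((osAdjoint (translateMulti (SchwingerFamily.timeVec T)
          ((osAdjoint P).appendTensor (P.appendTensor (translateMulti (SchwingerFamily.timeVec σ) Q))))).appendTensor
          (translateMulti (SchwingerFamily.timeVec T)
            ((osAdjoint P).appendTensor (P.appendTensor (translateMulti (SchwingerFamily.timeVec σ) Q)))))‖ ≤
        C * (1 + |σ|) ^ p := by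
  obtain ⟨M, C₀, hS⟩ := exists_bound' L
  set A : ℝ := 2 ^ (M + 1) * schwartzNorm M P * (2 ^ M * (2 * schwartzNorm M Q)) with hA
  have hA0 : 0 ≤ A := by have := schwartzNorm_nonneg M P; have := schwartzNorm_nonneg M Q; positivity
  set B : ℝ := 2 ^ M * (1 + |T|) ^ M * (2 * (2 ^ (M + 1) * schwartzNorm M P * A)) with hB
  have hB0 : 0 ≤ B := by have := schwartzNorm_nonneg M P; positivity
  have hR : ∀ σ : ℝ, schwartzNorm M (translateMulti (SchwingerFamily.timeVec T)
      ((osAdjoint P).appendTensor (P.appendTensor (translateMulti (SchwingerFamily.timeVec σ) Q)))) ≤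
      B * (1 + |σ|) ^ M := by
    intro σ
    have h1 := schwartzNorm_translateMulti_le M (SchwingerFamily.timeVec T)
      ((osAdjoint P).appendTensor (P.appendTensor (translateMulti (SchwingerFamily.timeVec σ) Q)))
    rw [norm_timeVec] at h1
    have hP := schwartzNorm_nonneg M P
    have hY : schwartzNorm M ((osAdjoint P).appendTensor
        (P.appendTensor (translateMulti (SchwingerFamily.timeVec σ) Q))) ≤
        2 ^ (M + 1) * schwartzNorm M P * (A * (1 + |σ|) ^ M) := by
      refine (schwartzNorm_appendTensor_le _ _ _).trans ?_
      refine mul_le_mul ?_ (schwartzNorm_stretch_le M P Q σ) (schwartzNorm_nonneg _ _) (by positivity)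
      exact mul_le_mul_of_nonneg_left (schwartzNorm_osAdjoint_le P M) (by positivity)
    refine h1.trans ?_
    calc 2 ^ M * (1 + |T|) ^ M * (2 * schwartzNorm M ((osAdjoint P).appendTensor
          (P.appendTensor (translateMulti (SchwingerFamily.timeVec σ) Q))))
        ≤ 2 ^ M * (1 + |T|) ^ M * (2 * (2 ^ (M + 1) * schwartzNorm M P * (A * (1 + |σ|) ^ M))) :=
          mul_le_mul_of_nonneg_left (mul_le_mul_of_nonneg_left hY (by norm_num)) (by positivity)
      _ = B * (1 + |σ|) ^ M := by ring
  refine ⟨|C₀| * (2 ^ (M + 1) * B * B), M + M, by positivity, fun σ => ?_⟩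
  refine (norm_apply_osAdjoint_appendTensor_le' L hS _ _).trans ?_
  have h1 := hR σ
  have hσ : (0 : ℝ) ≤ (1 + |σ|) ^ M := by positivity
  have h0 : (0 : ℝ) ≤ schwartzNorm M (translateMulti (SchwingerFamily.timeVec T)
      ((osAdjoint P).appendTensor (P.appendTensor (translateMulti (SchwingerFamily.timeVec σ) Q)))) :=
    schwartzNorm_nonneg _ _
  have h11 : schwartzNorm M (translateMulti (SchwingerFamily.timeVec T)
          ((osAdjoint P).appendTensor (P.appendTensor (translateMulti (SchwingerFamily.timeVec σ) Q)))) *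
        schwartzNorm M (translateMulti (SchwingerFamily.timeVec T)
          ((osAdjoint P).appendTensor (P.appendTensor (translateMulti (SchwingerFamily.timeVec σ) Q)))) ≤
      (B * (1 + |σ|) ^ M) * (B * (1 + |σ|) ^ M) :=
    mul_le_mul h1 h1 h0 (by positivity)
  calc |C₀| * (2 ^ (M + 1) * schwartzNorm M (translateMulti (SchwingerFamily.timeVec T)
          ((osAdjoint P).appendTensor (P.appendTensor (translateMulti (SchwingerFamily.timeVec σ) Q)))) *
        schwartzNorm M (translateMulti (SchwingerFamily.timeVec T)
          ((osAdjoint P).appendTensor (P.appendTensor (translateMulti (SchwingerFamily.timeVec σ) Q)))))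
      ≤ |C₀| * (2 ^ (M + 1) * ((B * (1 + |σ|) ^ M) * (B * (1 + |σ|) ^ M))) := by
        rw [mul_assoc (2 ^ (M + 1) : ℝ)]
        exact mul_le_mul_of_nonneg_left (mul_le_mul_of_nonneg_left h11 (by positivity)) (abs_nonneg _)
    _ = |C₀| * (2 ^ (M + 1) * B * B) * (1 + |σ|) ^ (M + M) := by rw [pow_add]; ring

/-! ### C. The sector extension of the labelled Gram kernel, the holomorphic stretching, one gap -/

open Literature.MathematicalPhysics.QuantumFieldTheory.LogSlot
  Literature.MathematicalPhysics.QuantumFieldTheory.OSEnvelope Literature.Analysis.Complex in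
/-- **The labelled Gram kernel of the one-gap stretching continues holomorphically to the two-slot
sector region of opening `π/2`** (port of `OneGap.exists_sector_extension`). -/
theorem exists_sector_extension_labelled {ι : Type} (S : LabelledSchwingerFamily ι E4)
    (h : OSReconstructionNoE1 S) {k l : ℕ} (κ : Fin (k + l) → ι)
    {P : 𝓢((Fin k → E4), ℂ)} {Q : 𝓢((Fin l → E4), ℂ)} {T : ℝ}
    (hP : IsTimeOrdered P) (hQ : IsTimeOrdered Q)
    (hPT : tsupport (P : (Fin k → E4) → ℂ) ⊆ {x | ∀ i, x i 0 < T})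
    (hQT : tsupport (Q : (Fin l → E4) → ℂ) ⊆ {x | ∀ i, T < x i 0})
    (hT : 0 ≤ T) :
    ∃ G : (Fin 2 → ℂ) → ℂ, DifferentiableOn ℂ G (Literature.Analysis.Complex.sectorRegion 1 (Real.pi / 2)) ∧
      ∀ u : Fin 2 → ℝ, (∀ j, 0 < u j) → G (fun j => (u j : ℂ)) =
        S ((k + l) + (k + l)) (Fin.append (κ ∘ Fin.rev) κ)
          ((osAdjoint (P.appendTensor (translateMulti (SchwingerFamily.timeVec (u 0)) Q))).appendTensor
            (P.appendTensor (translateMulti (SchwingerFamily.timeVec (u 1)) Q))) := by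
  -- label strings of the fixed vector and of the re-centred vectors
  set κQ : Fin l → ι := fun j => κ (Fin.natAdd k j) with hκQ
  set κR : Fin (k + (k + l)) → ι := Fin.append ((fun i : Fin k => κ (Fin.castAdd l i)) ∘ Fin.rev) κ with hκR
  -- the fixed vector `Ψ' = Ψ^{κ_Q}_{Q_{-T}}` and the re-centred vectors `V σ = Ψ^{κ_R}_{R(σ⁺)}`
  set Ψ' : h.Hilbert := h.fieldVec l κQ (translateMulti (SchwingerFamily.timeVec (-T)) Q)
    (isTimeOrdered_lower hQ hQT) with hΨ'
  have hRto : ∀ σ : ℝ, IsTimeOrdered (translateMulti (SchwingerFamily.timeVec T)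
      ((osAdjoint P).appendTensor (P.appendTensor (translateMulti (SchwingerFamily.timeVec (max σ 0)) Q)))) :=
    fun σ => isTimeOrdered_recentre hP hQ hPT hQT hT (le_max_right σ 0)
  set V : ℝ → h.Hilbert := fun σ => h.fieldVec (k + (k + l)) κR
    (translateMulti (SchwingerFamily.timeVec T)
      ((osAdjoint P).appendTensor (P.appendTensor (translateMulti (SchwingerFamily.timeVec (max σ 0)) Q))))
    (hRto σ) with hV
  have hFto : ∀ σ : ℝ, IsTimeOrdered (P.appendTensor (translateMulti (SchwingerFamily.timeVec (max σ 0)) Q)) :=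
    fun σ => isTimeOrdered_stretch hP hQ hPT hQT (le_max_right σ 0)
  -- the slot functions
  choose φ0 hφ0d hφ0r hφ0b using fun σ : ℝ => exists_holo_inner_transfer h Ψ' (V σ)
  choose φ1 hφ1d hφ1r hφ1b using fun σ : ℝ => exists_holo_inner_transfer h (V σ) Ψ'
  -- temperedness constants
  obtain ⟨CK, pK, hCK, hK⟩ := exists_norm_kernel_le' (S ((k + l) + (k + l)) (Fin.append (κ ∘ Fin.rev) κ)) P Q
  obtain ⟨CR, pR, hCR, hR⟩ := exists_norm_recentre_sq_le'
    (S ((k + (k + l)) + (k + (k + l))) (Fin.append (κR ∘ Fin.rev) κR)) P Q T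
  -- the norm of `V σ` grows polynomially
  have hVn : ∀ σ : ℝ, ‖V σ‖ ≤ (1 + CR) * (1 + |σ|) ^ pR := by
    intro σ
    have hsq : ‖V σ‖ ^ 2 ≤ CR * (1 + |σ|) ^ pR := by
      rw [hV, norm_fieldVec_sq]
      refine (Complex.re_le_norm _).trans ((hR (max σ 0)).trans ?_)
      have hm : |max σ 0| ≤ |σ| := by
        rw [abs_of_nonneg (le_max_right σ 0)]
        exact max_le (le_abs_self σ) (abs_nonneg σ)
      exact mul_le_mul_of_nonneg_left (pow_le_pow_left₀ (by positivity) (by linarith) pR) hCR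
    have h1 : (1 : ℝ) ≤ (1 + |σ|) ^ pR := one_le_pow₀ (by linarith [abs_nonneg σ])
    calc ‖V σ‖ ≤ 1 + ‖V σ‖ ^ 2 := le_one_add_sq _
      _ ≤ 1 + CR * (1 + |σ|) ^ pR := by linarith
      _ ≤ (1 + CR) * (1 + |σ|) ^ pR := by nlinarith
  -- `V` is continuous
  have hVc : Continuous V := by
    have hRc : Continuous fun σ : ℝ => translateMulti (SchwingerFamily.timeVec T)
        ((osAdjoint P).appendTensor (P.appendTensor (translateMulti (SchwingerFamily.timeVec (max σ 0)) Q))) := by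
      have h1 : Continuous fun σ : ℝ => P.appendTensor (translateMulti (SchwingerFamily.timeVec (max σ 0)) Q) :=
        (continuous_stretch P Q).comp (continuous_id.max continuous_const)
      exact (translateMulti (SchwingerFamily.timeVec (d := 4) T)).continuous.comp
        (continuous_appendTensor.comp (continuous_const.prodMk h1))
    exact continuous_iff_continuousAt.2 fun σ₀ =>
      tendsto_fieldVec h κR hRto (hRto σ₀) (hRc.tendsto σ₀)
  -- continuity of the slot functions in the real parameter
  have hc0 : ∀ τ : ℂ, 0 < τ.re → Continuous fun σ : ℝ => φ0 σ τ := by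
    intro τ hτ
    refine continuous_iff_continuousAt.2 fun σ₀ => ?_
    rw [ContinuousAt, tendsto_iff_norm_sub_tendsto_zero]
    refine squeeze_zero (fun σ => norm_nonneg _) (fun σ => norm_holo_inner_transfer_sub_right_le h Ψ'
      (V σ) (V σ₀) (hφ0d σ) (hφ0d σ₀) (hφ0r σ) (hφ0r σ₀) hτ) ?_
    have h1 : Tendsto (fun σ => V σ - V σ₀) (𝓝 σ₀) (𝓝 0) := by
      simpa using (hVc.tendsto σ₀).sub_const (V σ₀)
    simpa using (tendsto_const_nhds (x := 2 * ‖Ψ'‖)).mul h1.norm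
  have hc1 : ∀ τ : ℂ, 0 < τ.re → Continuous fun σ : ℝ => φ1 σ τ := by
    intro τ hτ
    refine continuous_iff_continuousAt.2 fun σ₀ => ?_
    rw [ContinuousAt, tendsto_iff_norm_sub_tendsto_zero]
    refine squeeze_zero (fun σ => norm_nonneg _) (fun σ => norm_holo_inner_transfer_sub_left_le h
      (V σ) (V σ₀) Ψ' (hφ1d σ) (hφ1d σ₀) (hφ1r σ) (hφ1r σ₀) hτ) ?_
    have h1 : Tendsto (fun σ => V σ - V σ₀) (𝓝 σ₀) (𝓝 0) := by
      simpa using (hVc.tendsto σ₀).sub_const (V σ₀)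
    simpa using (h1.norm.const_mul 2).mul (tendsto_const_nhds (x := ‖Ψ'‖))
  -- the kernel at nonnegative real points is the inner product of the stretched field vectors
  have hKreal : ∀ a b : ℝ, ∀ (ha : 0 ≤ a) (hb : 0 ≤ b),
      S ((k + l) + (k + l)) (Fin.append (κ ∘ Fin.rev) κ)
        ((osAdjoint (P.appendTensor (translateMulti (SchwingerFamily.timeVec a) Q))).appendTensor
          (P.appendTensor (translateMulti (SchwingerFamily.timeVec b) Q))) =
      ⟪h.fieldVec (k + l) κ _ (isTimeOrdered_stretch hP hQ hPT hQT ha),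
        h.fieldVec (k + l) κ _ (isTimeOrdered_stretch hP hQ hPT hQT hb)⟫_ℂ := by
    intro a b ha hb
    rw [inner_fieldVec_fieldVec']
  -- the slot functions at real points: the re-centred pairing identity
  have hreal0 : ∀ (σ : ℝ) (hσ : 0 < σ) (x : ℝ) (hx : 0 < x), φ0 σ x =
      S ((k + l) + (k + l)) (Fin.append (κ ∘ Fin.rev) κ)
        ((osAdjoint (P.appendTensor (translateMulti (SchwingerFamily.timeVec x) Q))).appendTensor
          (P.appendTensor (translateMulti (SchwingerFamily.timeVec σ) Q))) := by
    intro σ hσ x hx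
    rw [hφ0r σ x hx, hKreal x σ hx.le hσ.le, inner_stretch_eq_labelled S h κ P Q T hx.le _ _
      (isTimeOrdered_lower hQ hQT) (isTimeOrdered_recentre hP hQ hPT hQT hT hσ.le), hV]
    congr 2
    exact fieldVec_congr h _ (by rw [max_eq_left hσ.le]) _ _
  have hreal1 : ∀ (σ : ℝ) (hσ : 0 < σ) (x : ℝ) (hx : 0 < x), φ1 σ x =
      S ((k + l) + (k + l)) (Fin.append (κ ∘ Fin.rev) κ)
        ((osAdjoint (P.appendTensor (translateMulti (SchwingerFamily.timeVec σ) Q))).appendTensor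
          (P.appendTensor (translateMulti (SchwingerFamily.timeVec x) Q))) := by
    intro σ hσ x hx
    rw [hφ1r σ x hx, ← h.inner_transfer_left, ← inner_conj_symm, hKreal σ x hσ.le hx.le,
      ← inner_conj_symm (h.fieldVec (k + l) _ _ _), inner_stretch_eq_labelled S h κ P Q T hx.le _ _
      (isTimeOrdered_lower hQ hQT) (isTimeOrdered_recentre hP hQ hPT hQT hT hσ.le), hV]
    congr 3
    exact fieldVec_congr h _ (by rw [max_eq_left hσ.le]) _ _
  -- the data
  set Kfun : (Fin 2 → ℝ) → ℂ := fun u =>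
    S ((k + l) + (k + l)) (Fin.append (κ ∘ Fin.rev) κ)
      ((osAdjoint (P.appendTensor (translateMulti (SchwingerFamily.timeVec (u 0)) Q))).appendTensor
        (P.appendTensor (translateMulti (SchwingerFamily.timeVec (u 1)) Q))) with hKfun
  set E : Fin 2 → (Fin 1 → ℝ) → ℂ → ℂ := ![fun u' τ => φ0 (u' 0) τ, fun u' τ => φ1 (u' 0) τ] with hE
  have hnQ : 0 ≤ ‖Ψ'‖ := norm_nonneg _
  have hdata : IsSectorData (Real.pi / 2) Kfun E (CK * 4 ^ pK) (pK + pR)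
      (fun _ => 2 * ‖Ψ'‖ * (1 + CR) * 2 ^ pR) := by
    refine ⟨?_, by positivity, ?_, ?_, ?_, fun _ => by positivity, ?_, ?_⟩
    · -- continuity of the kernel on the open quadrant
      exact ((S ((k + l) + (k + l)) (Fin.append (κ ∘ Fin.rev) κ)).continuous.comp
        (continuous_kernelTest P Q)).continuousOn
    · -- polynomial bound of the kernel
      intro u hu
      have hne : ∀ j, ((u j : ℝ) : ℂ) ≠ 0 := fun j => by exact_mod_cast (hu j).ne'
      have hg1 : 1 ≤ gFactor (fun j => ((u j : ℝ) : ℂ)) := one_le_gFactor hne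
      have hprod : (1 + |u 0|) * (1 + |u 1|) ≤ 4 * gFactor (fun j => ((u j : ℝ) : ℂ)) := by
        rw [gFactor_fin_two hu, abs_of_pos (hu 0), abs_of_pos (hu 1)]
        have h0 := one_add_le_two_mul_add_inv (hu 0)
        have h1 := one_add_le_two_mul_add_inv (hu 1)
        have h0' : (0 : ℝ) ≤ 1 + u 0 := by linarith [hu 0]
        have h1' : (0 : ℝ) ≤ u 1 + (u 1)⁻¹ := by have := inv_pos.2 (hu 1); linarith [hu 1]
        calc (1 + u 0) * (1 + u 1) ≤ (2 * (u 0 + (u 0)⁻¹)) * (2 * (u 1 + (u 1)⁻¹)) :=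
              mul_le_mul h0 h1 (by linarith [hu 1]) (by linarith)
          _ = 4 * ((u 0 + (u 0)⁻¹) * (u 1 + (u 1)⁻¹)) := by ring
      calc ‖Kfun u‖ ≤ CK * ((1 + |u 0|) * (1 + |u 1|)) ^ pK := hK (u 0) (u 1)
        _ ≤ CK * (4 * gFactor (fun j => ((u j : ℝ) : ℂ))) ^ pK :=
            mul_le_mul_of_nonneg_left (pow_le_pow_left₀ (by positivity) hprod pK) hCK
        _ = CK * 4 ^ pK * gFactor (fun j => ((u j : ℝ) : ℂ)) ^ pK := by rw [mul_pow]; ring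
        _ ≤ CK * 4 ^ pK * gFactor (fun j => ((u j : ℝ) : ℂ)) ^ (pK + pR) :=
            mul_le_mul_of_nonneg_left (gFactor_pow_le_pow hne (Nat.le_add_right _ _)) (by positivity)
    · -- continuity of the slots in the real parameter
      intro i τ hτ
      fin_cases i
      · simp only [hE, Fin.zero_eta, Fin.isValue, Matrix.cons_val_zero]
        exact ((hc0 τ hτ.1).comp (continuous_apply 0)).continuousOn
      · simp only [hE, Fin.mk_one, Fin.isValue, Matrix.cons_val_one, Matrix.cons_val_fin_one]
        exact ((hc1 τ hτ.1).comp (continuous_apply 0)).continuousOn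
    · -- holomorphy of the slots
      intro i u' hu'
      fin_cases i
      · simpa [hE] using (hφ0d (u' 0)).mono fun τ hτ => hτ.1
      · simpa [hE] using (hφ1d (u' 0)).mono fun τ hτ => hτ.1
    · -- the slot bounds
      intro i c _ u' τ hu' hτ _
      have hne : ∀ j, ((u' j : ℝ) : ℂ) ≠ 0 := fun j => by exact_mod_cast (hu' j).ne'
      have hg1 : 1 ≤ gFactor (fun j => ((u' j : ℝ) : ℂ)) := one_le_gFactor hne
      have hτ1 : (1 : ℝ) ≤ ‖τ‖ + ‖τ‖⁻¹ := OSEnvelope.one_le_add_inv (norm_pos_iff.2 fun h0 => by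
        rw [h0] at hτ; simp at hτ)
      have hgrow : (1 + |u' 0|) ^ pR ≤ 2 ^ pR * gFactor (fun j => ((u' j : ℝ) : ℂ)) ^ (pK + pR) := by
        have h1 : 1 + |u' 0| ≤ 2 * gFactor (fun j => ((u' j : ℝ) : ℂ)) := by
          rw [gFactor_fin_one hu', abs_of_pos (hu' 0)]
          exact one_add_le_two_mul_add_inv (hu' 0)
        calc (1 + |u' 0|) ^ pR ≤ (2 * gFactor (fun j => ((u' j : ℝ) : ℂ))) ^ pR :=
              pow_le_pow_left₀ (by positivity) h1 pR
          _ = 2 ^ pR * gFactor (fun j => ((u' j : ℝ) : ℂ)) ^ pR := mul_pow _ _ _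
          _ ≤ 2 ^ pR * gFactor (fun j => ((u' j : ℝ) : ℂ)) ^ (pK + pR) :=
              mul_le_mul_of_nonneg_left (gFactor_pow_le_pow hne (Nat.le_add_left _ _)) (by positivity)
      have hVσ := hVn (u' 0)
      have key : 2 * ‖Ψ'‖ * ‖V (u' 0)‖ ≤
          2 * ‖Ψ'‖ * (1 + CR) * 2 ^ pR * gFactor (fun j => ((u' j : ℝ) : ℂ)) ^ (pK + pR) *
            (‖τ‖ + ‖τ‖⁻¹) ^ (pK + pR) := by
        have h2 : (1 : ℝ) ≤ (‖τ‖ + ‖τ‖⁻¹) ^ (pK + pR) := one_le_pow₀ hτ1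
        calc 2 * ‖Ψ'‖ * ‖V (u' 0)‖ ≤ 2 * ‖Ψ'‖ * ((1 + CR) * (1 + |u' 0|) ^ pR) :=
              mul_le_mul_of_nonneg_left hVσ (by positivity)
          _ ≤ 2 * ‖Ψ'‖ * ((1 + CR) * (2 ^ pR * gFactor (fun j => ((u' j : ℝ) : ℂ)) ^ (pK + pR))) := by
              gcongr
          _ = 2 * ‖Ψ'‖ * (1 + CR) * 2 ^ pR * gFactor (fun j => ((u' j : ℝ) : ℂ)) ^ (pK + pR) * 1 := by ring
          _ ≤ 2 * ‖Ψ'‖ * (1 + CR) * 2 ^ pR * gFactor (fun j => ((u' j : ℝ) : ℂ)) ^ (pK + pR) *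
              (‖τ‖ + ‖τ‖⁻¹) ^ (pK + pR) := by
              exact mul_le_mul_of_nonneg_left h2 (by positivity)
      fin_cases i
      · simp only [hE, Fin.zero_eta, Fin.isValue, Matrix.cons_val_zero]
        exact (norm_holo_inner_transfer_le h Ψ' (V (u' 0)) (hφ0d (u' 0)) (hφ0r (u' 0)) hτ).trans key
      · simp only [hE, Fin.mk_one, Fin.isValue, Matrix.cons_val_one, Matrix.cons_val_fin_one]
        refine (norm_holo_inner_transfer_le h (V (u' 0)) Ψ' (hφ1d (u' 0)) (hφ1r (u' 0)) hτ).trans ?_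
        rw [show 2 * ‖V (u' 0)‖ * ‖Ψ'‖ = 2 * ‖Ψ'‖ * ‖V (u' 0)‖ by ring]
        exact key
    · -- the slots at real points
      intro i u' hu' x hx
      fin_cases i
      · simp only [hE, Fin.zero_eta, Fin.isValue, Matrix.cons_val_zero]
        rw [hreal0 (u' 0) (hu' 0) x hx, hKfun]
        simp [Fin.insertNth_zero']
      · simp only [hE, Fin.mk_one, Fin.isValue, Matrix.cons_val_one, Matrix.cons_val_fin_one]
        rw [hreal1 (u' 0) (hu' 0) x hx, hKfun]
        have h0 : (1 : Fin 2).succAbove (0 : Fin 1) = 0 := by decide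
        have h0' : Fin.insertNth (α := fun _ : Fin 2 => ℝ) (1 : Fin 2) x u' 0 = u' 0 := by
          conv_lhs => rw [← h0]
          rw [Fin.insertNth_apply_succAbove]
        have h1' : Fin.insertNth (α := fun _ : Fin 2 => ℝ) (1 : Fin 2) x u' 1 = x := by
          simp
        simp only [h0', h1']
  obtain ⟨G, hGd, hGr⟩ := hdata.exists_extension (by positivity) le_rfl
  exact ⟨G, hGd, fun u hu => by rw [hGr u hu]⟩


/-! ### C2. The holomorphic `ℋ`-valued stretching and the one-gap conclusion (labelled) -/

/-- A point of the disc `D(2x, √2 x)` (`x > 0`) has `|Im w| < Re w`. -/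
theorem abs_im_lt_re_of_mem_ball' {x : ℝ} (hx : 0 < x) {w : ℂ} (hw : w ∈ Metric.ball ((2 * x : ℝ) : ℂ) (Real.sqrt 2 * x)) :
    0 < w.re ∧ |w.im| < w.re := by
  rw [Metric.mem_ball, dist_eq_norm] at hw
  have h2 : ‖w - ((2 * x : ℝ) : ℂ)‖ ^ 2 < (Real.sqrt 2 * x) ^ 2 := by
    exact pow_lt_pow_left₀ hw (norm_nonneg _) two_ne_zero
  rw [mul_pow, Real.sq_sqrt zero_le_two, Complex.sq_norm, Complex.normSq_apply] at h2
  simp only [Complex.sub_re, Complex.ofReal_re, Complex.sub_im, Complex.ofReal_im, sub_zero] at h2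
  have hre : 0 < w.re := by nlinarith [sq_nonneg w.im, sq_nonneg (w.re - 2 * x)]
  refine ⟨hre, abs_lt_of_sq_lt_sq ?_ hre.le⟩
  nlinarith [sq_nonneg (w.re - x)]

/-- `|Im ζ| < Re ζ` for both entries gives a point of the two-slot sector region of opening `π/2`. -/
theorem pair_mem_sectorRegion' {w z : ℂ} (hw : 0 < w.re ∧ |w.im| < w.re) (hz : 0 < z.re ∧ |z.im| < z.re) :
    (![w, z] : Fin 2 → ℂ) ∈ Literature.Analysis.Complex.sectorRegion 1 (Real.pi / 2) := by
  refine ⟨fun j => ?_, ?_⟩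
  · fin_cases j
    · simpa using hw.1
    · simpa using hz.1
  · have h := Summit.QuantumFields.YangMills.Cruxes.PlanarSpectralCone.TwoMirrorLightconeSlots.DiscSections.abs_arg_add_abs_arg_lt hw.1 hz.1
      (mul_lt_mul'' hw.2 hz.2 (abs_nonneg _) (abs_nonneg _))
    rw [Fin.sum_univ_two]
    simpa using h

/-- **The holomorphic `ℋ`-valued stretching, LABELLED.** With `T ≥ 0`, `P` below `T`, `Q` above `T`
and a label string `κ` there is `Ψ̂ : (Fin 1 → ℂ) → ℋ`, holomorphic on
`Ω = {z | 0 < Re z₀, |Im z₀| < Re z₀}`, with `Ψ̂(σ) = Ψ^κ_{P ⊗ Q_{σe₀}}` for every real `σ > 0`. -/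
theorem exists_holomorphic_stretch_labelled {ι : Type} (S : LabelledSchwingerFamily ι E4)
    (h : OSReconstructionNoE1 S) {k l : ℕ} (κ : Fin (k + l) → ι)
    {P : 𝓢((Fin k → E4), ℂ)} {Q : 𝓢((Fin l → E4), ℂ)} {T : ℝ}
    (hP : IsTimeOrdered P) (hQ : IsTimeOrdered Q)
    (hPT : tsupport (P : (Fin k → E4) → ℂ) ⊆ {x | ∀ i, x i 0 < T})
    (hQT : tsupport (Q : (Fin l → E4) → ℂ) ⊆ {x | ∀ i, T < x i 0}) (hT : 0 ≤ T) :
    ∃ Ψv : (Fin 1 → ℂ) → h.Hilbert,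
      DifferentiableOn ℂ Ψv {z : Fin 1 → ℂ | 0 < (z 0).re ∧ |(z 0).im| < (z 0).re} ∧
      ∀ σ : ℝ, ∀ hσ : 0 < σ, Ψv (fun _ => (σ : ℂ)) =
        h.fieldVec (k + l) κ (P.appendTensor (translateMulti (SchwingerFamily.timeVec σ) Q))
          (isTimeOrdered_stretch hP hQ hPT hQT hσ.le) := by
  obtain ⟨G, hGd, hGr⟩ := exists_sector_extension_labelled S h κ hP hQ hPT hQT hT
  have hFto : ∀ σ : ℝ, IsTimeOrdered (P.appendTensor (translateMulti (SchwingerFamily.timeVec (max σ 0)) Q)) :=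
    fun σ => isTimeOrdered_stretch hP hQ hPT hQT (le_max_right σ 0)
  set W : ℝ → h.Hilbert := fun σ => h.fieldVec (k + l) κ
    (P.appendTensor (translateMulti (SchwingerFamily.timeVec (max σ 0)) Q)) (hFto σ) with hW
  set Ω : Set (Fin 1 → ℂ) := {z | 0 < (z 0).re ∧ |(z 0).im| < (z 0).re} with hΩ
  have hmain := exists_holomorphic_gramVec (m := 1) (H := h.Hilbert) (Ω := Ω)
    (k := fun w z => G ![w 0, z 0]) (Φ := fun η => W (η 0)) ?_ ?_
  · obtain ⟨Ψv, hΨd, hΨr, -, -⟩ := hmain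
    refine ⟨Ψv, hΨd, fun σ hσ => ?_⟩
    have hmem : (fun _ : Fin 1 => ((σ : ℝ) : ℂ)) ∈ Ω := by
      refine ⟨by simpa using hσ, ?_⟩
      simpa using hσ
    have := hΨr (fun _ => σ) hmem
    rw [this, hW]
    exact fieldVec_congr h _ (by rw [max_eq_left hσ.le]) _ _
  · -- every point of `Ω` lies in a real-centred disc inside `Ω` on whose square `k` is holomorphic
    intro z hz
    obtain ⟨hx, hy⟩ := hz
    set x : ℝ := (z 0).re with hxdef
    refine ⟨fun _ => 2 * x, fun _ => Real.sqrt 2 * x, ?_, fun _ => by positivity, ?_, ?_⟩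
    · rw [mem_polydisc]
      intro i
      rw [show i = 0 from Subsingleton.elim i 0, Metric.mem_ball, dist_eq_norm]
      have h2 : ‖z 0 - ((2 * x : ℝ) : ℂ)‖ ^ 2 < (Real.sqrt 2 * x) ^ 2 := by
        rw [mul_pow, Real.sq_sqrt zero_le_two, Complex.sq_norm, Complex.normSq_apply]
        simp only [Complex.sub_re, Complex.ofReal_re, Complex.sub_im, Complex.ofReal_im, sub_zero]
        have hy' := abs_lt.1 hy
        nlinarith
      exact lt_of_pow_lt_pow_left₀ 2 (by positivity) h2
    · intro w hw
      rw [mem_polydisc] at hw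
      exact abs_im_lt_re_of_mem_ball' hx (hw 0)
    · have hlin : Differentiable ℂ (fun p : (Fin 1 → ℂ) × (Fin 1 → ℂ) => (![p.1 0, p.2 0] : Fin 2 → ℂ)) := by
        refine differentiable_pi.2 fun j => ?_
        have h1 : Differentiable ℂ fun p : (Fin 1 → ℂ) × (Fin 1 → ℂ) => p.1 0 :=
          (ContinuousLinearMap.proj (R := ℂ) (φ := fun _ : Fin 1 => ℂ) 0).differentiable.comp differentiable_fst
        have h2 : Differentiable ℂ fun p : (Fin 1 → ℂ) × (Fin 1 → ℂ) => p.2 0 :=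
          (ContinuousLinearMap.proj (R := ℂ) (φ := fun _ : Fin 1 => ℂ) 0).differentiable.comp differentiable_snd
        fin_cases j
        · simpa using h1
        · simpa using h2
      refine hGd.comp hlin.differentiableOn fun p hp => ?_
      rw [Set.mem_prod, mem_polydisc, mem_polydisc] at hp
      exact pair_mem_sectorRegion' (abs_im_lt_re_of_mem_ball' hx (hp.1 0)) (abs_im_lt_re_of_mem_ball' hx (hp.2 0))
  · -- the Gram identity at the real points of `Ω`
    intro η η' hη hη'
    have h0 : 0 < η 0 := by simpa using hη.1
    have h0' : 0 < η' 0 := by simpa using hη'.1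
    have hvec : (fun j => (((![η' 0, η 0] : Fin 2 → ℝ) j : ℝ) : ℂ)) = (![((η' 0 : ℝ) : ℂ), ((η 0 : ℝ) : ℂ)] : Fin 2 → ℂ) := by
      funext j; fin_cases j <;> simp
    have hpos : ∀ j, 0 < (![η' 0, η 0] : Fin 2 → ℝ) j := fun j => by fin_cases j <;> simpa
    show ⟪W (η' 0), W (η 0)⟫_ℂ = G ![((η' 0 : ℝ) : ℂ), ((η 0 : ℝ) : ℂ)]
    rw [← hvec, hGr _ hpos]
    simp only [Matrix.cons_val_zero, Matrix.cons_val_one, Matrix.cons_val_fin_one]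
    have e1 : W (η' 0) = h.fieldVec (k + l) κ
        (P.appendTensor (translateMulti (SchwingerFamily.timeVec (η' 0)) Q))
        (isTimeOrdered_stretch hP hQ hPT hQT h0'.le) :=
      fieldVec_congr h _ (by rw [max_eq_left h0'.le]) _ _
    have e2 : W (η 0) = h.fieldVec (k + l) κ
        (P.appendTensor (translateMulti (SchwingerFamily.timeVec (η 0)) Q))
        (isTimeOrdered_stretch hP hQ hPT hQT h0.le) :=
      fieldVec_congr h _ (by rw [max_eq_left h0.le]) _ _
    rw [e1, e2, inner_fieldVec_fieldVec']

/-- The one-gap conclusion for `T ≥ 0`, labelled. -/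
theorem inner_stretch_eq_zero_labelled {ι : Type} (S : LabelledSchwingerFamily ι E4)
    (h : OSReconstructionNoE1 S) {k l : ℕ} (κ : Fin (k + l) → ι)
    {P : 𝓢((Fin k → E4), ℂ)} {Q : 𝓢((Fin l → E4), ℂ)} {T : ℝ}
    (hP : IsTimeOrdered P) (hQ : IsTimeOrdered Q)
    (hPT : tsupport (P : (Fin k → E4) → ℂ) ⊆ {x | ∀ i, x i 0 < T})
    (hQT : tsupport (Q : (Fin l → E4) → ℂ) ⊆ {x | ∀ i, T < x i 0}) (hT : 0 ≤ T)
    (χ : h.Hilbert) (s₀ : ℝ)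
    (hχ : ∀ s : ℝ, s₀ ≤ s → 0 ≤ s →
      ∀ hs : IsTimeOrdered (P.appendTensor (translateMulti (SchwingerFamily.timeVec s) Q)),
        ⟪χ, h.fieldVec (k + l) κ _ hs⟫_ℂ = 0)
    (s : ℝ) (hs0 : 0 ≤ s)
    (hs : IsTimeOrdered (P.appendTensor (translateMulti (SchwingerFamily.timeVec s) Q))) :
    ⟪χ, h.fieldVec (k + l) κ _ hs⟫_ℂ = 0 := by
  obtain ⟨Ψv, hΨd, hΨr⟩ := exists_holomorphic_stretch_labelled S h κ hP hQ hPT hQT hT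
  -- the scalar function `g ζ = ⟪χ, Ψ̂ ζ⟫` on `U = {0 < Re ζ, |Im ζ| < Re ζ}`
  set U : Set ℂ := {ζ : ℂ | 0 < ζ.re ∧ |ζ.im| < ζ.re} with hU
  set g : ℂ → ℂ := fun ζ => ⟪χ, Ψv (fun _ => ζ)⟫_ℂ with hg
  have hUo : IsOpen U :=
    (isOpen_lt continuous_const Complex.continuous_re).inter
      (isOpen_lt (continuous_abs.comp Complex.continuous_im) Complex.continuous_re)
  have hUc : Convex ℝ U := by
    have e : U = {ζ : ℂ | 0 < ζ.re} ∩ ({ζ : ℂ | ζ.im - ζ.re < 0} ∩ {ζ : ℂ | -ζ.im - ζ.re < 0}) := by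
      ext ζ
      simp only [hU, Set.mem_setOf_eq, Set.mem_inter_iff, abs_lt]
      constructor
      · rintro ⟨h1, h2, h3⟩; exact ⟨h1, by linarith, by linarith⟩
      · rintro ⟨h1, h2, h3⟩; exact ⟨h1, by linarith, by linarith⟩
    rw [e]
    refine (convex_halfSpace_re_gt 0).inter ((convex_halfSpace_lt ?_ 0).inter (convex_halfSpace_lt ?_ 0))
    · exact ⟨fun x y => by simp only [Complex.add_im, Complex.add_re]; ring,
        fun c x => by simp only [Complex.real_smul, Complex.mul_im, Complex.mul_re, Complex.ofReal_re,
          Complex.ofReal_im, zero_mul, sub_zero, add_zero, smul_eq_mul]; ring⟩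
    · exact ⟨fun x y => by simp only [Complex.add_im, Complex.add_re, neg_add]; ring,
        fun c x => by simp only [Complex.real_smul, Complex.mul_im, Complex.mul_re, Complex.ofReal_re,
          Complex.ofReal_im, zero_mul, sub_zero, add_zero, smul_eq_mul]; ring⟩
  have hgd : DifferentiableOn ℂ g U := by
    have h1 : DifferentiableOn ℂ (fun ζ : ℂ => Ψv (fun _ => ζ)) U := by
      refine hΨd.comp (differentiableOn_pi.2 fun _ => differentiableOn_id) fun ζ hζ => ?_
      exact hζ
    exact (innerSL ℂ χ).differentiable.comp_differentiableOn h1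
  -- `g` vanishes at the real points `> max s₀ 0`
  have hg0 : ∀ σ : ℝ, max s₀ 0 < σ → g σ = 0 := by
    intro σ hσ
    have hσ0 : 0 < σ := lt_of_le_of_lt (le_max_right _ _) hσ
    show ⟪χ, Ψv (fun _ => (σ : ℂ))⟫_ℂ = 0
    rw [hΨr σ hσ0]
    exact hχ σ ((le_max_left _ _).trans hσ.le) hσ0.le _
  -- hence on `U` (identity theorem along `z₀ + 1/(n+1)`, `z₀ = max s₀ 0 + 1`)
  set z₀ : ℝ := max s₀ 0 + 1 with hz₀
  have hz₀0 : 0 < z₀ := by have := le_max_right s₀ 0; linarith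
  have hz₀U : ((z₀ : ℝ) : ℂ) ∈ U := ⟨by simpa using hz₀0, by simpa using hz₀0⟩
  have hfreq : ∃ᶠ ζ in 𝓝[≠] ((z₀ : ℝ) : ℂ), g ζ = 0 := by
    refine ((tendsto_ofReal_add_inv_nhdsWithin z₀).frequently
      ((Eventually.of_forall fun n => ?_).frequently))
    show g ((z₀ + 1 / ((n : ℝ) + 1) : ℝ) : ℂ) = 0
    have hpos : (0 : ℝ) < 1 / ((n : ℝ) + 1) := by positivity
    exact hg0 _ (by linarith)
  have hgU : EqOn g 0 U :=
    (hgd.analyticOnNhd hUo).eqOn_zero_of_preconnected_of_frequently_eq_zero hUc.isPreconnected hz₀U hfreq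
  -- conclusion for `s > 0`
  have hpos : ∀ σ : ℝ, ∀ hσ : 0 < σ,
      ⟪χ, h.fieldVec (k + l) κ (P.appendTensor (translateMulti (SchwingerFamily.timeVec σ) Q))
        (isTimeOrdered_stretch hP hQ hPT hQT hσ.le)⟫_ℂ = 0 := by
    intro σ hσ
    have h1 := hgU (⟨by simpa using hσ, by simpa using hσ⟩ : ((σ : ℝ) : ℂ) ∈ U)
    simp only [hg, Pi.zero_apply] at h1
    rwa [hΨr σ hσ] at h1
  rcases hs0.eq_or_lt with hs0' | hs0'
  · -- `s = 0`: continuity of the stretching at `0`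
    subst hs0'
    have hlim : Tendsto (fun n : ℕ => P.appendTensor (translateMulti (SchwingerFamily.timeVec (1 / ((n : ℝ) + 1))) Q))
        atTop (𝓝 (P.appendTensor (translateMulti (SchwingerFamily.timeVec 0) Q))) :=
      ((continuous_stretch P Q).tendsto 0).comp tendsto_one_div_add_atTop_nhds_zero_nat
    have ht := tendsto_fieldVec h κ (fun n : ℕ => isTimeOrdered_stretch hP hQ hPT hQT
      (by positivity : (0 : ℝ) ≤ 1 / ((n : ℝ) + 1))) hs hlim
    have ht' : Tendsto (fun n : ℕ => ⟪χ, h.fieldVec (k + l) κ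
        (P.appendTensor (translateMulti (SchwingerFamily.timeVec (1 / ((n : ℝ) + 1))) Q))
        (isTimeOrdered_stretch hP hQ hPT hQT (by positivity : (0 : ℝ) ≤ 1 / ((n : ℝ) + 1)))⟫_ℂ)
        atTop (𝓝 ⟪χ, h.fieldVec (k + l) κ
          (P.appendTensor (translateMulti (SchwingerFamily.timeVec 0) Q)) hs⟫_ℂ) :=
      (tendsto_const_nhds (x := χ)).inner ht
    have h0 : Tendsto (fun n : ℕ => ⟪χ, h.fieldVec (k + l) κ
        (P.appendTensor (translateMulti (SchwingerFamily.timeVec (1 / ((n : ℝ) + 1))) Q))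
        (isTimeOrdered_stretch hP hQ hPT hQT (by positivity : (0 : ℝ) ≤ 1 / ((n : ℝ) + 1)))⟫_ℂ)
        atTop (𝓝 0) := by
      have : ∀ n : ℕ, ⟪χ, h.fieldVec (k + l) κ
          (P.appendTensor (translateMulti (SchwingerFamily.timeVec (1 / ((n : ℝ) + 1))) Q))
          (isTimeOrdered_stretch hP hQ hPT hQT (by positivity : (0 : ℝ) ≤ 1 / ((n : ℝ) + 1)))⟫_ℂ = 0 :=
        fun n => hpos _ (by positivity)
      simp only [this]
      exact tendsto_const_nhds
    exact tendsto_nhds_unique ht' h0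
  · exact hpos s hs0'

/-- **ONE GAP, labelled** (the registered stub of the birth skeleton): for `P` (`k` points, times
`< T`) and `Q` (`l` points, times `> T`) time-ordered and `Ψ(s) = Ψ^κ_{P ⊗ Q_{s e₀}}`, if
`χ ⊥ Ψ(s)` for all `s ≥ s₀` then `χ ⊥ Ψ(s)` for all `s ≥ 0`. Proof: replace `T` by `max T 0`. -/
theorem oneGap_labelled {ι : Type} (S : LabelledSchwingerFamily ι E4) (h : OSReconstructionNoE1 S)
    {k l : ℕ} (κ : Fin (k + l) → ι) (P : 𝓢((Fin k → E4), ℂ)) (Q : 𝓢((Fin l → E4), ℂ)) (T : ℝ)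
    (hP : IsTimeOrdered P) (hQ : IsTimeOrdered Q)
    (hPT : tsupport (P : (Fin k → E4) → ℂ) ⊆ {x | ∀ i, x i 0 < T})
    (hQT : tsupport (Q : (Fin l → E4) → ℂ) ⊆ {x | ∀ i, T < x i 0})
    (χ : h.Hilbert) (s₀ : ℝ)
    (hχ : ∀ s : ℝ, s₀ ≤ s → 0 ≤ s →
      ∀ hs : IsTimeOrdered (P.appendTensor (translateMulti (SchwingerFamily.timeVec s) Q)),
        ⟪χ, h.fieldVec (k + l) κ _ hs⟫_ℂ = 0)
    (s : ℝ) (hs0 : 0 ≤ s)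
    (hs : IsTimeOrdered (P.appendTensor (translateMulti (SchwingerFamily.timeVec s) Q))) :
    ⟪χ, h.fieldVec (k + l) κ _ hs⟫_ℂ = 0 := by
  have hPT' : tsupport (P : (Fin k → E4) → ℂ) ⊆ {x | ∀ i, x i 0 < max T 0} :=
    fun x hx i => (hPT hx i).trans_le (le_max_left _ _)
  have hQT' : tsupport (Q : (Fin l → E4) → ℂ) ⊆ {x | ∀ i, max T 0 < x i 0} :=
    fun x hx i => max_lt (hQT hx i) ((hQ hx).1 i)
  exact inner_stretch_eq_zero_labelled S h κ hP hQ hPT' hQT' (le_max_right _ _) χ s₀ hχ s hs0 hs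


end OneGapL

namespace DensityL

/-! ### D. First-gap absorption and the induction over the leading gaps (labelled) -/

/-- **First-gap absorption, LABELLED.** A vector `χ` orthogonal to the field vectors of all strict
cone chains (all label strings) is orthogonal to `Ψ^κ_F` for every time-ordered `F` that is internally
cone-ordered with `|xᵢ¹| ≤ D` on its support. -/
theorem inner_fieldVec_eq_zero_of_internallyConed_labelled {ι : Type} (S : LabelledSchwingerFamily ι E4)
    (h : OSReconstructionNoE1 S) (χ : h.Hilbert)
    (hχ : ∀ (m : ℕ) (κ : Fin m → ι) (G : 𝓢((Fin m → E4), ℂ)) (hG : IsTimeOrdered G),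
      tsupport (G : (Fin m → E4) → ℂ) ⊆
        {x | (∀ i, |x i 1| < x i 0) ∧ ∀ i j, i < j → |x j 1 - x i 1| < x j 0 - x i 0} →
      ⟪χ, h.fieldVec m κ G hG⟫_ℂ = 0)
    {m : ℕ} (κ : Fin m → ι) (F : 𝓢((Fin m → E4), ℂ)) (hF : IsTimeOrdered F) (D : ℝ)
    (hFD : tsupport (F : (Fin m → E4) → ℂ) ⊆
        {x | (∀ i, |x i 1| ≤ D) ∧ ∀ i j, i < j → |x j 1 - x i 1| < x j 0 - x i 0}) :
    ⟪χ, h.fieldVec m κ F hF⟫_ℂ = 0 := by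
  set ψF := h.fieldVec m κ F hF with hψF
  -- Step 1: beyond `max D 0` the translated function is a cone chain
  have step1 : ∀ s : ℝ, max D 0 < s → ⟪χ, h.transfer s ψF⟫_ℂ = 0 := by
    intro s hs
    have hs0 : 0 ≤ s := le_trans (le_max_right _ _) hs.le
    rw [hψF, h.transfer_fieldVec hs0]
    exact hχ m κ _ _ (Density.coneChain_translate_timeVec F hF D hFD hs)
  -- Step 2: the holomorphic function (complex-time matrix element at `a = 0`)
  obtain ⟨-, g, hgd', -, -, hgr⟩ :=
    Summit.QuantumFields.YangMills.Cruxes.PlanarSpectralCone.TwoMirrorLightconeSlots.stub_complexTimeSlot h χ ψF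
  have hgd : DifferentiableOn ℂ (g 0) {τ : ℂ | 0 < τ.re} := hgd' 0
  have hg_real : ∀ x : ℝ, 0 < x → g 0 x = ⟪χ, h.transfer x ψF⟫_ℂ := fun x hx => by
    rw [hgr 0 rfl x hx, h.translate_zero_apply]
  -- Step 3: identity theorem on the right half-plane
  have hU : IsOpen {τ : ℂ | 0 < τ.re} := isOpen_lt continuous_const Complex.continuous_re
  have hUc : IsPreconnected {τ : ℂ | 0 < τ.re} := (convex_halfSpace_re_gt 0).isPreconnected
  have hga : AnalyticOnNhd ℂ (g 0) {τ : ℂ | 0 < τ.re} := hgd.analyticOnNhd hU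
  set c : ℝ := max D 0 + 1 with hc
  have hc0 : 0 < c := by rw [hc]; positivity
  have hz₀ : ((c : ℝ) : ℂ) ∈ {τ : ℂ | 0 < τ.re} := by simpa using hc0
  have hfreq : ∃ᶠ z in 𝓝[≠] ((c : ℝ) : ℂ), g 0 z = 0 := by
    set u : ℕ → ℂ := fun n => (((c + 1 / ((n : ℝ) + 1) : ℝ)) : ℂ) with hu
    have hut : Tendsto u atTop (𝓝[≠] ((c : ℝ) : ℂ)) := by
      rw [tendsto_nhdsWithin_iff]
      refine ⟨?_, Eventually.of_forall fun n => ?_⟩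
      · have h1 : Tendsto (fun n : ℕ => c + 1 / ((n : ℝ) + 1)) atTop (𝓝 (c + 0)) :=
          (tendsto_const_nhds (x := c) (f := (atTop : Filter ℕ))).add
            tendsto_one_div_add_atTop_nhds_zero_nat
        rw [add_zero] at h1
        exact (Complex.continuous_ofReal.tendsto c).comp h1
      · simp only [hu, Set.mem_compl_iff, Set.mem_singleton_iff, Complex.ofReal_inj]
        have : 0 < 1 / ((n : ℝ) + 1) := by positivity
        linarith
    have hall : ∀ n, g 0 (u n) = 0 := by
      intro n
      have hpos : 0 < c + 1 / ((n : ℝ) + 1) := by positivity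
      have hgt : max D 0 < c + 1 / ((n : ℝ) + 1) := by
        have : 0 < 1 / ((n : ℝ) + 1) := by positivity
        rw [hc]; linarith
      simp only [hu]
      rw [hg_real _ hpos]
      exact step1 _ hgt
    exact hut.frequently (Frequently.of_forall hall)
  have hzero : EqOn (g 0) 0 {τ : ℂ | 0 < τ.re} :=
    hga.eqOn_zero_of_preconnected_of_frequently_eq_zero hUc hz₀ hfreq
  -- Step 4: all positive times
  have step4 : ∀ x : ℝ, 0 < x → ⟪χ, h.transfer x ψF⟫_ℂ = 0 := by
    intro x hx
    rw [← hg_real x hx]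
    exact hzero (by simpa using hx)
  -- Step 5: strong continuity at `0`
  have hcont : Continuous fun t : ℝ => ⟪χ, h.transfer t ψF⟫_ℂ :=
    (continuous_const : Continuous fun _ : ℝ => χ).inner (h.continuous_transfer_apply ψF)
  have hlim : Tendsto (fun t : ℝ => ⟪χ, h.transfer t ψF⟫_ℂ) (𝓝[>] 0)
      (𝓝 ⟪χ, h.transfer 0 ψF⟫_ℂ) :=
    (hcont.tendsto 0).mono_left nhdsWithin_le_nhds
  have hlim0 : Tendsto (fun t : ℝ => ⟪χ, h.transfer t ψF⟫_ℂ) (𝓝[>] 0) (𝓝 0) := by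
    refine tendsto_const_nhds.congr' ?_
    filter_upwards [self_mem_nhdsWithin] with t ht
    exact (step4 t ht).symm
  have heq := tendsto_nhds_unique hlim hlim0
  rwa [h.transfer_zero, ContinuousLinearMap.id_apply] at heq

/-- **All pairs wide ⇒ orthogonal, LABELLED** (base of the induction). -/
theorem inner_tensorFin_eq_zero_of_allWide_labelled {ι : Type} (S : LabelledSchwingerFamily ι E4)
    (h : OSReconstructionNoE1 S) (χ : h.Hilbert)
    (hχ : ∀ (m : ℕ) (κ : Fin m → ι) (G : 𝓢((Fin m → E4), ℂ)) (hG : IsTimeOrdered G),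
      tsupport (G : (Fin m → E4) → ℂ) ⊆
        {x | (∀ i, |x i 1| < x i 0) ∧ ∀ i j, i < j → |x j 1 - x i 1| < x j 0 - x i 0} →
      ⟪χ, h.fieldVec m κ G hG⟫_ℂ = 0)
    {n : ℕ} (κ : Fin n → ι) {f : Fin n → 𝓢(E4, ℂ)} {a b : Fin n → ℝ} {ρ : ℝ}
    (hf : ∀ i, tsupport (f i : E4 → ℂ) ⊆ {x | a i ≤ x 0 ∧ x 0 ≤ b i ∧ |x 1| ≤ ρ})
    (hwide : ∀ i j, i < j → b i + 2 * ρ < a j) (hG : IsTimeOrdered (SchwartzMap.tensorFin n f)) :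
    ⟪χ, h.fieldVec n κ (SchwartzMap.tensorFin n f) hG⟫_ℂ = 0 := by
  refine inner_fieldVec_eq_zero_of_internallyConed_labelled S h χ hχ κ _ hG ρ fun x hx => ?_
  have hw := fun i => hf i (apply_mem_tsupport_of_mem_tsupport_tensorFin f hx i)
  refine ⟨fun i => (hw i).2.2, fun i j hij => ?_⟩
  have h1 : |x j 1 - x i 1| ≤ |x j 1| + |x i 1| := abs_sub _ _
  have h2 := (hw i).2.2
  have h3 := (hw j).2.2
  have h4 := hwide i j hij
  have h5 := (hw i).2.1
  have h6 := (hw j).1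
  show |x j 1 - x i 1| < x j 0 - x i 0
  linarith

/-- **Induction over the leading gaps, LABELLED** (arrow form over the labelled one-gap statement):
`χ ⊥ Ψ^κ_{⊗ fᵢ}` for all windowed data whose pairs of windows from index `J` on are wide. -/
theorem inner_tensorFin_eq_zero_of_wideFrom_labelled {ι : Type} (S : LabelledSchwingerFamily ι E4)
    (h : OSReconstructionNoE1 S)
    (h_oneGap : ∀ {k l : ℕ} (κ : Fin (k + l) → ι) (P : 𝓢((Fin k → E4), ℂ)) (Q : 𝓢((Fin l → E4), ℂ))
      (T : ℝ), IsTimeOrdered P → IsTimeOrdered Q →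
      tsupport (P : (Fin k → E4) → ℂ) ⊆ {x | ∀ i, x i 0 < T} →
      tsupport (Q : (Fin l → E4) → ℂ) ⊆ {x | ∀ i, T < x i 0} →
      ∀ (χ : h.Hilbert) (s₀ : ℝ),
      (∀ s : ℝ, s₀ ≤ s → 0 ≤ s →
        ∀ hs : IsTimeOrdered (P.appendTensor (translateMulti (SchwingerFamily.timeVec s) Q)),
          ⟪χ, h.fieldVec (k + l) κ _ hs⟫_ℂ = 0) →
      ∀ (s : ℝ), 0 ≤ s →
        ∀ hs : IsTimeOrdered (P.appendTensor (translateMulti (SchwingerFamily.timeVec s) Q)),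
          ⟪χ, h.fieldVec (k + l) κ _ hs⟫_ℂ = 0)
    (χ : h.Hilbert)
    (hχ : ∀ (m : ℕ) (κ : Fin m → ι) (G : 𝓢((Fin m → E4), ℂ)) (hG : IsTimeOrdered G),
      tsupport (G : (Fin m → E4) → ℂ) ⊆
        {x | (∀ i, |x i 1| < x i 0) ∧ ∀ i j, i < j → |x j 1 - x i 1| < x j 0 - x i 0} →
      ⟪χ, h.fieldVec m κ G hG⟫_ℂ = 0)
    (J : ℕ) :
    ∀ (n : ℕ) (κ : Fin n → ι) (f : Fin n → 𝓢(E4, ℂ)) (a b : Fin n → ℝ) (ρ : ℝ),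
      (∀ i, 0 < a i) → (∀ i j, i < j → b i < a j) →
      (∀ i, tsupport (f i : E4 → ℂ) ⊆ {x | a i ≤ x 0 ∧ x 0 ≤ b i ∧ |x 1| ≤ ρ}) →
      (∀ i j : Fin n, i < j → J ≤ i.val → b i + 2 * ρ < a j) →
      ∀ hG : IsTimeOrdered (SchwartzMap.tensorFin n f),
        ⟪χ, h.fieldVec n κ (SchwartzMap.tensorFin n f) hG⟫_ℂ = 0 := by
  induction J with
  | zero =>
    intro n κ f a b ρ _ _ hf hwide hG
    exact inner_tensorFin_eq_zero_of_allWide_labelled S h χ hχ κ hf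
      (fun i j hij => hwide i j hij (Nat.zero_le _)) hG
  | succ J ih =>
    intro n κ f a b ρ ha hab hf hwide hG
    rcases le_or_gt n (J + 1) with hle | hlt
    · exact ih n κ f a b ρ ha hab hf (fun i j hij hJ => by
        have h1 := j.isLt
        have h2 : (i : ℕ) < j := hij
        omega) hG
    obtain ⟨l, rfl⟩ : ∃ l, n = (J + 1) + (l + 1) := by
      obtain ⟨l, hl⟩ := Nat.exists_eq_add_of_lt hlt
      exact ⟨l, by omega⟩
    -- the split `⊗ f = P ⊗ Q` after the first `J + 1` factors
    set P : 𝓢((Fin (J + 1) → E4), ℂ) :=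
      SchwartzMap.tensorFin (J + 1) fun i => f (Fin.castAdd (l + 1) i) with hP_def
    set Q : 𝓢((Fin (l + 1) → E4), ℂ) :=
      SchwartzMap.tensorFin (l + 1) fun j => f (Fin.natAdd (J + 1) j) with hQ_def
    have hP : IsTimeOrdered P :=
      Density.isTimeOrdered_tensorFin_windowed (fun i => ha _)
        (fun i j hij => hab (Fin.castAdd (l + 1) i) (Fin.castAdd (l + 1) j) hij) fun i => hf _
    have hQ : IsTimeOrdered Q :=
      Density.isTimeOrdered_tensorFin_windowed (fun j => ha _)
        (fun i j hij => hab (Fin.natAdd (J + 1) i) (Fin.natAdd (J + 1) j)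
          (Nat.add_lt_add_left (Fin.lt_def.1 hij) (J + 1))) fun j => hf _
    obtain ⟨hPT, hQT⟩ := Density.levels_of_windowed (f := f) hab hf
    -- the stretched products are tensor products of stretched windowed data
    have hid : ∀ s : ℝ, P.appendTensor (translateMulti (SchwingerFamily.timeVec s) Q) =
        SchwartzMap.tensorFin ((J + 1) + (l + 1)) (Fin.append (fun i => f (Fin.castAdd (l + 1) i))
          fun j => translateTest (SchwingerFamily.timeVec s) (f (Fin.natAdd (J + 1) j))) :=
      fun s => Density.appendTensor_translateMulti_tensorFin _ _ _
    have hfar : ∀ s : ℝ, 2 * ρ ≤ s → 0 ≤ s →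
        ∀ hs : IsTimeOrdered (P.appendTensor (translateMulti (SchwingerFamily.timeVec s) Q)),
          ⟪χ, h.fieldVec ((J + 1) + (l + 1)) κ _ hs⟫_ℂ = 0 := by
      intro s h2ρ hs0 hs
      have hs' : IsTimeOrdered (SchwartzMap.tensorFin ((J + 1) + (l + 1))
          (Fin.append (fun i => f (Fin.castAdd (l + 1) i))
            fun j => translateTest (SchwingerFamily.timeVec s) (f (Fin.natAdd (J + 1) j)))) := by
        rw [← hid s]; exact hs
      rw [fieldVec_congr h κ (hid s) hs hs']
      obtain ⟨ha', hab', hwide'⟩ := Density.windows_append_shift (l := l) ha hab hwide h2ρ hs0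
      exact ih _ κ _ _ _ ρ ha' hab' (Density.tsupport_append_shift hf s) hwide' hs'
    -- back to `s = 0` by the one-gap principle
    have hid0 : P.appendTensor (translateMulti (SchwingerFamily.timeVec 0) Q) =
        SchwartzMap.tensorFin ((J + 1) + (l + 1)) f := by
      rw [SchwingerFamily.timeVec_zero, translateMulti_zero, hP_def, hQ_def, ← tensorFin_add]
    have hs0 : IsTimeOrdered (P.appendTensor (translateMulti (SchwingerFamily.timeVec 0) Q)) := by
      rw [hid0]; exact hG
    have h0 := h_oneGap κ P Q _ hP hQ hPT hQT χ (2 * ρ) hfar 0 le_rfl hs0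
    rwa [fieldVec_congr h κ hid0 hs0 hG] at h0

/-! ### E. Closure: labelled linearity of `F ↦ Ψ^κ_F` and windowed density -/

/-- **`Ψ^κ_{F+G} = Ψ^κ_F + Ψ^κ_G`** in `ℋ` (labelled). -/
theorem fieldVec_add_labelled {ι : Type} {S : LabelledSchwingerFamily ι E4} (h : OSReconstructionNoE1 S)
    {n : ℕ} (κ : Fin n → ι) {F G : 𝓢((Fin n → E4), ℂ)} (hF : IsTimeOrdered F)
    (hG : IsTimeOrdered G) (hFG : IsTimeOrdered (F + G)) :
    h.fieldVec n κ (F + G) hFG = h.fieldVec n κ F hF + h.fieldVec n κ G hG := by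
  rw [← sub_eq_zero, ← inner_self_eq_zero (𝕜 := ℂ)]
  simp only [inner_sub_left, inner_sub_right, inner_add_left, inner_add_right,
    inner_fieldVec_fieldVec', osAdjoint_add, SchwartzMap.appendTensor_add_left,
    SchwartzMap.appendTensor_add_right, map_add]
  ring

/-- **`Ψ^κ_{cF} = c Ψ^κ_F`** in `ℋ` (labelled). -/
theorem fieldVec_smul_labelled {ι : Type} {S : LabelledSchwingerFamily ι E4} (h : OSReconstructionNoE1 S)
    {n : ℕ} (κ : Fin n → ι) (c : ℂ) {F : 𝓢((Fin n → E4), ℂ)}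
    (hF : IsTimeOrdered F) (hcF : IsTimeOrdered (c • F)) :
    h.fieldVec n κ (c • F) hcF = c • h.fieldVec n κ F hF := by
  rw [← sub_eq_zero, ← inner_self_eq_zero (𝕜 := ℂ)]
  simp only [inner_sub_left, inner_sub_right, inner_smul_left, inner_smul_right,
    inner_fieldVec_fieldVec', Literature.MathematicalPhysics.QuantumLattice.osAdjoint_smul,
    SchwartzMap.appendTensor_smul_left, SchwartzMap.appendTensor_smul_right, map_smul, smul_eq_mul]
  ring

/-- **`Ψ^κ_0 = 0`** (labelled). -/
theorem fieldVec_zero_labelled {ι : Type} {S : LabelledSchwingerFamily ι E4} (h : OSReconstructionNoE1 S)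
    {n : ℕ} (κ : Fin n → ι) (h0 : IsTimeOrdered (0 : 𝓢((Fin n → E4), ℂ))) :
    h.fieldVec n κ 0 h0 = 0 := by
  rw [← inner_self_eq_zero (𝕜 := ℂ), inner_fieldVec_fieldVec']
  have : ((osAdjoint (0 : 𝓢((Fin n → E4), ℂ))).appendTensor (0 : 𝓢((Fin n → E4), ℂ))) = 0 := by
    ext x; simp
  rw [this, map_zero]

/-- **The span of the windowed tensor products, LABELLED**: every element is time-ordered and, if
`χ` is orthogonal to all `Ψ^κ` of windowed tensor products, orthogonal to `χ`. -/
theorem inner_eq_zero_of_mem_span_windowed_labelled {ι : Type} (S : LabelledSchwingerFamily ι E4)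
    (h : OSReconstructionNoE1 S) (χ : h.Hilbert) {n : ℕ} (κ : Fin n → ι)
    (hW : ∀ (f : Fin n → 𝓢(E4, ℂ)) (a b : Fin n → ℝ) (ρ : ℝ),
      (∀ i, 0 < a i) → (∀ i j, i < j → b i < a j) →
      (∀ i, tsupport (f i : E4 → ℂ) ⊆ {x | a i ≤ x 0 ∧ x 0 ≤ b i ∧ |x 1| ≤ ρ}) →
      ∀ hG : IsTimeOrdered (SchwartzMap.tensorFin n f),
        ⟪χ, h.fieldVec n κ (SchwartzMap.tensorFin n f) hG⟫_ℂ = 0)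
    {G : 𝓢((Fin n → E4), ℂ)}
    (hGW : G ∈ (Submodule.span ℂ
      {G : 𝓢((Fin n → E4), ℂ) |
        ∃ (f : Fin n → 𝓢(E4, ℂ)) (a b : Fin n → ℝ) (ρ : ℝ),
        (∀ i, 0 < a i) ∧ (∀ i j, i < j → b i < a j) ∧
        (∀ i, tsupport (f i : E4 → ℂ) ⊆ {x | a i ≤ x 0 ∧ x 0 ≤ b i ∧ |x 1| ≤ ρ}) ∧
        IsTensorOf G f} : Submodule ℂ 𝓢((Fin n → E4), ℂ))) :
    IsTimeOrdered G ∧ ∀ hG : IsTimeOrdered G, ⟪χ, h.fieldVec n κ G hG⟫_ℂ = 0 := by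
  induction hGW using Submodule.span_induction with
  | mem G hG =>
    obtain ⟨f, a, b, ρ, ha, hab, hf, hGf⟩ := hG
    obtain rfl : G = SchwartzMap.tensorFin n f := hGf.unique (isTensorOf_tensorFin f)
    exact ⟨Density.isTimeOrdered_tensorFin_windowed ha hab hf, hW f a b ρ ha hab hf⟩
  | zero =>
    refine ⟨fun x hx => ?_, fun h0 => by rw [fieldVec_zero_labelled h κ h0, inner_zero_right]⟩
    rw [FunLike.coe_zero, tsupport_zero] at hx
    exact absurd hx (Set.notMem_empty x)
  | add F G _ _ hF hG =>
    refine ⟨isTimeOrdered_add hF.1 hG.1, fun hFG => ?_⟩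
    rw [fieldVec_add_labelled h κ hF.1 hG.1 hFG, inner_add_right, hF.2, hG.2, add_zero]
  | smul c F _ hF =>
    refine ⟨OSReconstructionNoE1.isTimeOrdered_smul c hF.1, fun hcF => ?_⟩
    rw [fieldVec_smul_labelled h κ c hF.1 hcF, inner_smul_right, hF.2, mul_zero]

/-- **CLOSURE, labelled**: orthogonality to all windowed tensor products of arity `n` (label `κ`)
gives orthogonality to `Ψ^κ_F` for every time-ordered `F` of arity `n` (`stub_windowedDensity`, landed
and label-free; linearity and continuity of `F ↦ Ψ^κ_F`). -/
theorem closure_labelled {ι : Type} (S : LabelledSchwingerFamily ι E4) (h : OSReconstructionNoE1 S)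
    (χ : h.Hilbert) {n : ℕ} (κ : Fin n → ι)
    (hW : ∀ (f : Fin n → 𝓢(E4, ℂ)) (a b : Fin n → ℝ) (ρ : ℝ),
      (∀ i, 0 < a i) → (∀ i j, i < j → b i < a j) →
      (∀ i, tsupport (f i : E4 → ℂ) ⊆ {x | a i ≤ x 0 ∧ x 0 ≤ b i ∧ |x 1| ≤ ρ}) →
      ∀ hG : IsTimeOrdered (SchwartzMap.tensorFin n f),
        ⟪χ, h.fieldVec n κ (SchwartzMap.tensorFin n f) hG⟫_ℂ = 0)
    (F : 𝓢((Fin n → E4), ℂ)) (hF : IsTimeOrdered F) :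
    ⟪χ, h.fieldVec n κ F hF⟫_ℂ = 0 := by
  obtain ⟨u, huW, hu⟩ := mem_closure_iff_seq_limit.1 (stub_windowedDensity F hF)
  have hP := fun j => inner_eq_zero_of_mem_span_windowed_labelled S h χ κ hW (huW j)
  have ht : Tendsto (fun j => ⟪χ, h.fieldVec n κ (u j) (hP j).1⟫_ℂ) atTop
      (𝓝 ⟪χ, h.fieldVec n κ F hF⟫_ℂ) :=
    (tendsto_const_nhds (x := χ)).inner (tendsto_fieldVec h κ (fun j => (hP j).1) hF hu)
  have h0 : Tendsto (fun j => ⟪χ, h.fieldVec n κ (u j) (hP j).1⟫_ℂ) atTop (𝓝 0) := by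
    have : ∀ j, ⟪χ, h.fieldVec n κ (u j) (hP j).1⟫_ℂ = 0 := fun j => (hP j).2 _
    simp only [this]; exact tendsto_const_nhds
  exact tendsto_nhds_unique ht h0

/-! ### The piece -/

/-- **LABELLED TOTALITY of field vectors**: a vector orthogonal to every `Ψ^κ_F` is zero. -/
theorem eq_zero_of_forall_inner_fieldVec_eq_zero_labelled {ι : Type}
    {S : LabelledSchwingerFamily ι E4} (h : OSReconstructionNoE1 S) (χ : h.Hilbert)
    (hχ : ∀ (n : ℕ) (κ : Fin n → ι) (F : 𝓢((Fin n → E4), ℂ)) (hF : IsTimeOrdered F),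
      ⟪χ, h.fieldVec n κ F hF⟫_ℂ = 0) :
    χ = 0 := by
  have hall : ∀ x : h.Hilbert, ⟪χ, x⟫_ℂ = 0 := by
    intro x
    refine h.denseRange_vec.induction_on x (isClosed_eq (continuous_const.inner continuous_id)
      continuous_const) fun v => ?_
    rw [h.vec_eq_sum_genVec, Finsupp.sum, inner_sum]
    refine Finset.sum_eq_zero fun p _ => ?_
    rw [inner_smul_right]
    obtain ⟨n, k, F, hF⟩ := p
    have : h.genVec ⟨n, k, F, hF⟩ = h.fieldVec n k F hF := (h.fieldVec_eq_genVec n k F hF).symm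
    rw [this, hχ n k F hF, mul_zero]
  exact inner_self_eq_zero.1 (hall χ)

end DensityL

open DensityL OneGapL in
/-- **`TransparentRPWall.LabelledConeChainDensity` (stmt-QuantumFields-18619) — PROOF.** In the `e₀` OS
space of ANY labelled Schwinger family with E2 and translations on `⁰𝒮`, the field vectors of strict
cone chains (all arities, all label strings) span a dense subspace: `Dense ↔ (span)ᗮ = ⊥`; a vector `χ`
orthogonal to the span is orthogonal to every cone-chain vector, hence (induction over the gaps with the
labelled one-gap lemma, `J = n`) to every windowed tensor product, hence (closure) to every field vector,
hence zero (labelled totality). The statement is INLINE (verbatim the body of the route decl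
`Summit.QuantumFields.QCD.Theses.TransparentRPWall.LabelledConeChainDensity`). [folklore] -/
theorem labelledConeChainDensity_proof :
    (open Literature.MathematicalPhysics.QuantumLattice Literature.MathematicalPhysics.AQFT Literature.MathematicalPhysics.QuantumFieldTheory in let E := EuclideanSpace ℝ (Fin 4); ∀ (ι : Type) (S : LabelledSchwingerFamily ι E) (h : OSReconstructionNoE1 S), Dense ((Submodule.span ℂ {ψ : h.Hilbert | ∃ (m : ℕ) (k : Fin m → ι) (G : SchwartzMap (Fin m → E) ℂ) (hG : IsTimeOrdered G), tsupport (G : (Fin m → E) → ℂ) ⊆ {x | (∀ i, |x i 1| < x i 0) ∧ ∀ i j, i < j → |x j 1 - x i 1| < x j 0 - x i 0} ∧ ψ = h.fieldVec m k G hG} : Submodule ℂ h.Hilbert) : Set h.Hilbert)) := by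
  intro E ι S h
  rw [Submodule.dense_iff_topologicalClosure_eq_top, Submodule.topologicalClosure_eq_top_iff,
    Submodule.eq_bot_iff]
  intro χ hχ
  -- `χ` is orthogonal to every cone-chain vector
  have hχ' : ∀ (m : ℕ) (κ : Fin m → ι) (G : 𝓢((Fin m → E4), ℂ)) (hG : IsTimeOrdered G),
      tsupport (G : (Fin m → E4) → ℂ) ⊆
        {x | (∀ i, |x i 1| < x i 0) ∧ ∀ i j, i < j → |x j 1 - x i 1| < x j 0 - x i 0} →
      ⟪χ, h.fieldVec m κ G hG⟫_ℂ = 0 := by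
    intro m κ G hG hC
    have hk : h.fieldVec m κ G hG ∈ Submodule.span ℂ
        {ψ : h.Hilbert | ∃ (m : ℕ) (k : Fin m → ι) (G : 𝓢((Fin m → E4), ℂ)) (hG : IsTimeOrdered G),
          tsupport (G : (Fin m → E4) → ℂ) ⊆
            {x | (∀ i, |x i 1| < x i 0) ∧ ∀ i j, i < j → |x j 1 - x i 1| < x j 0 - x i 0} ∧
          ψ = h.fieldVec m k G hG} :=
      Submodule.subset_span ⟨m, κ, G, hG, hC, rfl⟩
    rw [← inner_conj_symm, Submodule.inner_right_of_mem_orthogonal hk hχ, map_zero]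
  -- hence to every windowed tensor product (`J = n`: no pair of windows is constrained)
  have hwin : ∀ (n : ℕ) (κ : Fin n → ι) (f : Fin n → 𝓢(E4, ℂ)) (a b : Fin n → ℝ) (ρ : ℝ),
      (∀ i, 0 < a i) → (∀ i j, i < j → b i < a j) →
      (∀ i, tsupport (f i : E4 → ℂ) ⊆ {x | a i ≤ x 0 ∧ x 0 ≤ b i ∧ |x 1| ≤ ρ}) →
      ∀ hG : IsTimeOrdered (SchwartzMap.tensorFin n f),
        ⟪χ, h.fieldVec n κ (SchwartzMap.tensorFin n f) hG⟫_ℂ = 0 := by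
    intro n κ f a b ρ ha hab hf hG
    exact inner_tensorFin_eq_zero_of_wideFrom_labelled S h (fun κ' P Q T => oneGap_labelled S h κ' P Q T)
      χ hχ' n n κ f a b ρ ha hab hf
      (fun i j _ hJ => by
        have h1 := i.isLt
        omega) hG
  -- hence to every field vector, hence zero
  refine eq_zero_of_forall_inner_fieldVec_eq_zero_labelled h χ fun n κ F hF => ?_
  exact closure_labelled S h χ κ (hwin n κ) F hF

end Summit.QuantumFields.QCD.Theorems.LabelledConeChainDensityProof

end


/-!
# `LabelledPlanarSpectralCone` — the crux-strategist's SPLIT (support for stmt-QuantumFields-9910)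

Crux `stmt-QuantumFields-9910` (`TransparentRPWall.LabelledPlanarSpectralCone`, sub `QCD`): the
labelled planar spectral cone — for a labelled Schwinger family `S` over ANY label type `ι` on `ℝ⁴`
with E0', E3, translations on `⁰𝒮` and reflection positivity in pull-back form for the eight frames of
the `(x₀,x₁)`-plane, the two-variable matrix elements `(t,b) ↦ 𝔖_{n+m}^{rev k ++ k'}(ΘF* ⊗ G_{te₀+be₁})`
extend to holomorphic contraction families on `{|Im β| < Re ζ}`, i.e. `spec(H,P₁) ⊂ {E ≥ |p₁|}` on the
OS space of all species. Its one-species case `MirrorModularBoosts.PlanarSpectralCone`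
(stmt-QuantumFields-9664, sub `YangMills`) is PROVED in the tree (`PlanarSpectralCone_of`, line
`positivity-disc-to-operator-cone`, `Theorems/MirrorModularBoostsPlanarSpectralCone*.lean`).

This file is the labelled twin of that line's kernel-checked TOP CUT. Of the line's five stubs, three
are already landed in LABEL-GENERIC form and are used here by name —

* `stub_linearity` (SpanLinearity: null sets of joint spectral measures pass to the closed span; any
  labels, any dimension),
* `stub_cone_of_discSections` (DelayedLever: the measure-theoretic lever, disc sections with a
  `t`-uniform bound ⇒ the measure charges nothing outside the closed cone),
* `Contraction.contractionFamily` (Transfer: the abstract holomorphic contraction family on the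
  operator cone, stated for `OSReconstructionNoE1 T` with `T` any labelled family) —

while the two stubs whose landed proofs are written for ONE species (`fun _ => ()` labels) become
the two pieces of the split, re-typed with label strings:

* `X₁` = **LabelledConeDiscSections** (FRONT END): translations on `⁰𝒮` + eight-frame pull-back RP
  ⇒ for every cone-chain field vector `Ψ = Ψ_G^{k}` of the `e₀` OS space the diagonal matrix element
  `b ↦ ⟪Ψ, e^{-tH} U(b e₁) Ψ⟫` has, for every `t > c`, a holomorphic extension to the disc of radius
  `t − c` bounded by ONE constant `M` (port of FrontEnd/ConeChainFrames/DiscSections with labels);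
* `X₂` = **LabelledConeChainDensity** (DENSITY): in the `e₀` OS space of any labelled family the
  cone-chain field vectors (all arities, all label strings) span a dense subspace (port of
  DensityOfParts/DensityHelpers/OneGap*; `stub_windowedDensity` is label-free and landed).

`LabelledPlanarSpectralCone_of_subs : X₁ → X₂ → LabelledPlanarSpectralCone`, sorry-free, ~70 lines of
glue: the `e₀`-frame reconstruction `h : OSReconstructionNoE1 S` exists under the crux hypotheses
(E2 = the frame `R = 1`, `a = 1`, `b = 0`; translations relabelled); `stub_linearity` reduces cone
support of every joint spectral measure to the cone-chain vectors (`X₂`), for which `X₁` feeds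
`stub_cone_of_discSections` through `IsJointSpectralMeasure.inner_transfer_translate`; then
`contractionFamily` at `(Ψ_F^{k}, Ψ_G^{k'})` is read back as Schwinger functions with label string
`rev k ++ k'` (`translate_fieldVec`, `transfer_fieldVec`, `inner_fieldVec_fieldVec`), and the bound
`‖Φ‖ ≤ ‖Ψ_F‖‖Ψ_G‖` squares to `‖𝔖_{2n}^{rev k ++ k}(ΘF*⊗F)‖ ‖𝔖_{2m}^{rev k' ++ k'}(ΘG*⊗G)‖`.
The module imports NO route file (all three statements inline, verbatim the route decls' bodies), so
the gate can link it as the glue of `route edit --split LabelledPlanarSpectralCone` (`--glue-by`).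
Strategist's file (planner-cstrat-stmt-QuantumFields-9910-r1-0). [folklore]
-/

noncomputable section

namespace Summit.QuantumFields.QCD.Theorems.LabelledPlanarSpectralConeSplit

open MeasureTheory
open scoped InnerProductSpace SchwartzMap
open Literature.MathematicalPhysics.QuantumLattice Literature.MathematicalPhysics.AQFT
  Literature.MathematicalPhysics.QuantumFieldTheory
open Summit.QuantumFields.YangMills.Cruxes.PlanarSpectralCone.PositivityDiscToOperatorCone
open Summit.QuantumFields.YangMills.Cruxes.PlanarSpectralCone.TwoMirrorLightconeSlots

/-- Euclidean `ℝ⁴`, time = coordinate `0`, the boost plane = coordinates `0, 1`. -/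
local notation "E4" => EuclideanSpace ℝ (Fin 4)

/-- The pull-back of a labelled family by the identity frame is the family itself. [folklore] -/
theorem pullback_refl_labelled {ι : Type} (S : LabelledSchwingerFamily ι E4) :
    (fun n (k : Fin n → ι) => (S n k).comp (linActMulti (LinearIsometryEquiv.refl ℝ E4))) = S := by
  funext n k
  refine ContinuousLinearMap.ext fun F => ?_
  have hF : linActMulti (LinearIsometryEquiv.refl ℝ E4) F = F := SchwartzMap.ext fun _ => rfl
  rw [ContinuousLinearMap.comp_apply, hF]

/-- **The `e₀`-frame OS reconstruction of a labelled family exists under the crux hypotheses**: E2 is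
the eight-frame hypothesis at `R = 1` (`a = 1`, `b = 0`), translation invariance on `⁰𝒮` is the crux
hypothesis. [folklore] -/
theorem osReconstruction_e0_labelled {ι : Type} (S : LabelledSchwingerFamily ι E4)
    (htr : ∀ (n : ℕ) (k : Fin n → ι) (a : E4) (F : 𝓢((Fin n → E4), ℂ)), IsOffDiagonal F →
      S n k (translateMulti a F) = S n k F)
    (hRP : ∀ (R : E4 ≃ₗᵢ[ℝ] E4) (a b : ℝ), a ^ 2 + b ^ 2 = 1 → (a = 0 ∨ b = 0 ∨ a ^ 2 = b ^ 2) →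
      R (EuclideanSpace.single 0 1) = a • EuclideanSpace.single 0 1 + b • EuclideanSpace.single 1 1 →
        LabelledSchwingerFamily.IsReflectionPositive
          (fun n (k : Fin n → ι) => (S n k).comp (linActMulti R))) :
    OSReconstructionNoE1 S := by
  refine ⟨?_, fun n k a F hF => htr n k a F hF⟩
  have h1 := hRP (LinearIsometryEquiv.refl ℝ E4) 1 0 (by norm_num) (Or.inr (Or.inl rfl)) (by simp)
  rwa [pullback_refl_labelled] at h1

/-- The complement `{p₀ < |p₁|}` of the closed planar cone is open, hence Borel. [folklore] -/
theorem measurableSet_coneCompl' : MeasurableSet {p : E4 | p 0 < |p 1|} := by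
  have h0 : Continuous fun p : E4 => p 0 := by fun_prop
  have h1 : Continuous fun p : E4 => |p 1| := by fun_prop
  exact (isOpen_lt h0 h1).measurableSet

/-- `⟪b e₁, p⟫ = b p₁` — matches the Fourier phase of `IsJointSpectralMeasure` at `a = b e₁` with the
integrand of the lever. [folklore] -/
theorem inner_single_one' (b : ℝ) (p : E4) :
    inner ℝ (EuclideanSpace.single (1 : Fin 4) b) p = b * p 1 := by
  simp [EuclideanSpace.inner_single_left]

/-- **THE SPLIT**: `LabelledConeDiscSections → LabelledConeChainDensity → LabelledPlanarSpectralCone`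
(the three statements inline, verbatim the bodies of the route decls of
`Summits/QuantumFields/QCD/Theses/TransparentRPWall.lean`). [folklore] -/
theorem LabelledPlanarSpectralCone_of_subs :
    (open Literature.MathematicalPhysics.QuantumLattice Literature.MathematicalPhysics.AQFT Literature.MathematicalPhysics.QuantumFieldTheory in let E := EuclideanSpace ℝ (Fin 4); ∀ (ι : Type) (S : LabelledSchwingerFamily ι E), (∀ (n : ℕ) (k : Fin n → ι) (a : E) (F : SchwartzMap (Fin n → E) ℂ), IsOffDiagonal F → S n k (translateMulti a F) = S n k F) → (∀ (R : E ≃ₗᵢ[ℝ] E) (a b : ℝ), a ^ 2 + b ^ 2 = 1 → (a = 0 ∨ b = 0 ∨ a ^ 2 = b ^ 2) → R (EuclideanSpace.single 0 1) = a • EuclideanSpace.single 0 1 + b • EuclideanSpace.single 1 1 → LabelledSchwingerFamily.IsReflectionPositive (fun n (k : Fin n → ι) => (S n k).comp (linActMulti R))) → ∀ (h : OSReconstructionNoE1 S) (m : ℕ) (k : Fin m → ι) (G : SchwartzMap (Fin m → E) ℂ) (hG : IsTimeOrdered G), tsupport (G : (Fin m → E) → ℂ) ⊆ {x | (∀ i,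 |x i 1| < x i 0) ∧ ∀ i j, i < j → |x j 1 - x i 1| < x j 0 - x i 0} → ∃ c M : ℝ, 0 ≤ c ∧ ∀ t : ℝ, c < t → ∃ f : ℂ → ℂ, DifferentiableOn ℂ f (Metric.ball 0 (t - c)) ∧ (∀ z ∈ Metric.ball (0 : ℂ) (t - c), ‖f z‖ ≤ M) ∧ ∀ b : ℝ, |b| < t - c → f b = inner ℂ (h.fieldVec m k G hG) (h.transfer t (h.translate (EuclideanSpace.single 1 b) (h.fieldVec m k G hG)))) →
    (open Literature.MathematicalPhysics.QuantumLattice Literature.MathematicalPhysics.AQFT Literature.MathematicalPhysics.QuantumFieldTheory in let E := EuclideanSpace ℝ (Fin 4); ∀ (ι : Type) (S : LabelledSchwingerFamily ι E) (h : OSReconstructionNoE1 S), Dense ((Submodule.span ℂ {ψ : h.Hilbert | ∃ (m : ℕ) (k : Fin m → ι) (G : SchwartzMap (Fin m → E) ℂ) (hG : IsTimeOrdered G), tsupport (G : (Fin m → E) → ℂ) ⊆ {x | (∀ i, |x i 1| < x i 0) ∧ ∀ i j, i < j → |x j 1 - x i 1| < x j 0 - x i 0} ∧ ψ = h.fieldVec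 m k G hG} : Submodule ℂ h.Hilbert) : Set h.Hilbert)) →
    (open Literature.MathematicalPhysics.QuantumLattice Literature.MathematicalPhysics.AQFT Literature.MathematicalPhysics.QuantumFieldTheory in let E := EuclideanSpace ℝ (Fin 4); ∀ (ι : Type) (S : LabelledSchwingerFamily ι E), S.HasLinearGrowth → S.IsSymmetric → (∀ (n : ℕ) (k : Fin n → ι) (a : E) (F : SchwartzMap (Fin n → E) ℂ), IsOffDiagonal F → S n k (translateMulti a F) = S n k F) → (∀ (R : E ≃ₗᵢ[ℝ] E) (a b : ℝ), a ^ 2 + b ^ 2 = 1 → (a = 0 ∨ b = 0 ∨ a ^ 2 = b ^ 2) → R (EuclideanSpace.single 0 1) = a • EuclideanSpace.single 0 1 + b • EuclideanSpace.single 1 1 → LabelledSchwingerFamily.IsReflectionPositive (fun n (k : Fin n → ι) => (S n k).comp (linActMulti R))) → (∀ (n m : ℕ) (k : Fin n → ι) (k' : Fin m → ι) (F : SchwartzMap (Fin n → E) ℂ) (G : SchwartzMap (Fin m → E) ℂ), IsTimeOrdered F → IsTimeOrdered G → ∃ Φ : ℂ × ℂ → ℂ, DifferentiableOn ℂ Φ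 {w : ℂ × ℂ | |w.2.im| < w.1.re} ∧ (∀ (t b : ℝ), 0 < t → ∀ H : SchwartzMap (Fin (n + m) → E) ℂ, IsAppendTensorOf H (osAdjoint F) (translateMulti (t • EuclideanSpace.single 0 1 + b • EuclideanSpace.single 1 1) G) → Φ ((t : ℂ), (b : ℂ)) = S (n + m) (Fin.append (k ∘ Fin.rev) k') H) ∧ (∀ w ∈ {w : ℂ × ℂ | |w.2.im| < w.1.re}, ∀ (HF : SchwartzMap (Fin (n + n) → E) ℂ) (HG : SchwartzMap (Fin (m + m) → E) ℂ), IsAppendTensorOf HF (osAdjoint F) F → IsAppendTensorOf HG (osAdjoint G) G → ‖Φ w‖ ^ 2 ≤ ‖S (n + n) (Fin.append (k ∘ Fin.rev) k) HF‖ * ‖S (m + m) (Fin.append (k' ∘ Fin.rev) k') HG‖))) := by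
  intro hX1 hX2 E ι S hlg hsym htr hRP n m k k' F G hF hG
  -- E0' (`hlg`) and E3 (`hsym`) are idle (as in the one-species line; cdisprove `sharpened_implies_crux`)
  have _ := hlg
  have _ := hsym
  -- (1) the `e₀`-frame OS reconstruction
  have h : OSReconstructionNoE1 S := osReconstruction_e0_labelled S htr hRP
  -- (2) the operator cone `C⁺`: every joint spectral measure of every vector is carried by `{p₀ ≥ |p₁|}`
  have hcone : ∀ (ψ : h.Hilbert) (μ : Measure E4), h.IsJointSpectralMeasure ψ μ →
      μ {p | p 0 < |p 1|} = 0 := by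
    intro ψ μ hμ
    refine stub_linearity h measurableSet_coneCompl' (hX2 ι S h) ?_ ψ μ hμ
    rintro ψ' ⟨m', κ, G', hG', hC, rfl⟩ μ' hμ'
    obtain ⟨c, M, hc, hdisc⟩ := hX1 ι S htr hRP h m' κ G' hG' hC
    haveI := hμ'.isFiniteMeasure
    refine stub_cone_of_discSections μ' hμ'.energy_nonneg c M hc fun t ht => ?_
    obtain ⟨f, hf, hfM, hfb⟩ := hdisc t ht
    refine ⟨f, hf, hfM, fun b hb => ?_⟩
    rw [hfb b hb, hμ'.inner_transfer_translate t (hc.trans_lt ht).le (EuclideanSpace.single 1 b)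
      (by simp)]
    simp_rw [inner_single_one']
  -- (3) transfer `C⁺ ⇒ C`: the contraction family of `(Ψ_F^{k}, Ψ_G^{k'})`, read back as Schwinger functions
  obtain ⟨Φ, hΦd, hΦr, hΦb⟩ := Contraction.contractionFamily h hcone
    (h.fieldVec n k F hF) (h.fieldVec m k' G hG)
  refine ⟨Φ, hΦd, ?_, ?_⟩
  · intro t b ht H hH
    rw [hΦr t b ht, OSReconstructionNoE1.translate_fieldVec,
      OSReconstructionNoE1.transfer_fieldVec _ ht.le]
    have hH' : IsAppendTensorOf H (osAdjoint F) (translateMulti (SchwingerFamily.timeVec t)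
        (translateMulti (spatialPart 0 (b • (EuclideanSpace.single 1 1 : E4))) G)) := by
      rw [DiscSections.translateMulti_time_space]; exact hH
    rw [h.inner_fieldVec_fieldVec k k' hF _ hH']
  · intro w hw HF HG hHF hHG
    have hb := hΦb w hw
    have hsq : ∀ {j : ℕ} (κ : Fin j → ι) (A : 𝓢((Fin j → E4), ℂ)) (hA : IsTimeOrdered A)
        (HA : 𝓢((Fin (j + j) → E4), ℂ)),
        IsAppendTensorOf HA (osAdjoint A) A →
          ‖S (j + j) (Fin.append (κ ∘ Fin.rev) κ) HA‖ = ‖h.fieldVec j κ A hA‖ ^ 2 := by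
      intro j κ A hA HA hHA
      have e := h.inner_fieldVec_fieldVec κ κ hA hA hHA
      rw [← e, inner_self_eq_norm_sq_to_K, norm_pow, RCLike.norm_ofReal, abs_norm]
    rw [hsq k F hF HF hHF, hsq k' G hG HG hHG, ← mul_pow]
    exact pow_le_pow_left₀ (norm_nonneg _) hb 2

end Summit.QuantumFields.QCD.Theorems.LabelledPlanarSpectralConeSplit

end


/-! # The crux `TransparentRPWall.LabelledPlanarSpectralCone` (stmt-QuantumFields-9910) — PROOF (candidate)

`labelledPlanarSpectralCone_proof` : the crux statement INLINE (verbatim the body of the route decl), from the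
two piece proofs and the split glue above. Strategist-written (planner-cstrat-stmt-QuantumFields-9910-r1-0);
lean check rc 0, 0 sorries. A prover lands the four developments as separate Theorems files. [folklore] -/

namespace Summit.QuantumFields.QCD.Theorems.LabelledPlanarSpectralConeProof

theorem labelledPlanarSpectralCone_proof :
    (open Literature.MathematicalPhysics.QuantumLattice Literature.MathematicalPhysics.AQFT Literature.MathematicalPhysics.QuantumFieldTheory in let E := EuclideanSpace ℝ (Fin 4); ∀ (ι : Type) (S : LabelledSchwingerFamily ι E), S.HasLinearGrowth → S.IsSymmetric → (∀ (n : ℕ) (k : Fin n → ι) (a : E) (F : SchwartzMap (Fin n → E) ℂ), IsOffDiagonal F → S n k (translateMulti a F) = S n k F) → (∀ (R : E ≃ₗᵢ[ℝ] E) (a b : ℝ), a ^ 2 + b ^ 2 = 1 → (a = 0 ∨ b = 0 ∨ a ^ 2 = b ^ 2) → R (EuclideanSpace.single 0 1) = a • EuclideanSpace.single 0 1 + b • EuclideanSpace.single 1 1 → LabelledSchwingerFamily.IsReflectionPositive (fun n (k : Fin n → ι) => (S n k).comp (linActMulti R))) → (∀ (n m : ℕ) (k : Fin n → ι) (k' :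 Fin m → ι) (F : SchwartzMap (Fin n → E) ℂ) (G : SchwartzMap (Fin m → E) ℂ), IsTimeOrdered F → IsTimeOrdered G → ∃ Φ : ℂ × ℂ → ℂ, DifferentiableOn ℂ Φ {w : ℂ × ℂ | |w.2.im| < w.1.re} ∧ (∀ (t b : ℝ), 0 < t → ∀ H : SchwartzMap (Fin (n + m) → E) ℂ, IsAppendTensorOf H (osAdjoint F) (translateMulti (t • EuclideanSpace.single 0 1 + b • EuclideanSpace.single 1 1) G) → Φ ((t : ℂ), (b : ℂ)) = S (n + m) (Fin.append (k ∘ Fin.rev) k') H) ∧ (∀ w ∈ {w : ℂ × ℂ | |w.2.im| < w.1.re}, ∀ (HF : SchwartzMap (Fin (n + n) → E) ℂ) (HG : SchwartzMap (Fin (m + m) → E) ℂ), IsAppendTensorOf HF (osAdjoint F) F → IsAppendTensorOf HG (osAdjoint G) G → ‖Φ w‖ ^ 2 ≤ ‖S (n + n) (Fin.append (k ∘ Fin.rev) k) HF‖ * ‖S (m + m) (Fin.append (k' ∘ Fin.rev) k') HG‖))) :=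
  Summit.QuantumFields.QCD.Theorems.LabelledPlanarSpectralConeSplit.LabelledPlanarSpectralCone_of_subs
    Summit.QuantumFields.QCD.Theorems.LabelledConeDiscSectionsProof.labelledConeDiscSections_proof
    Summit.QuantumFields.QCD.Theorems.LabelledConeChainDensityProof.labelledConeChainDensity_proof

end Summit.QuantumFields.QCD.Theorems.LabelledPlanarSpectralConeProof
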